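import Summits.QuantumFields.YangMills.Theses.PencilRigidity
import Summits.QuantumFields.YangMills.Theses.MirrorModularBoosts
import Literature.MathematicalPhysics.QuantumFieldTheory.LatticeGaugeStrongCouplingProofs
import Literature.MathematicalPhysics.QuantumFieldTheory.YangMillsEuclideanProofs
import Literature.MathematicalPhysics.QuantumFieldTheory.TorusFreeTransfer
import Literature.MathematicalPhysics.AQFT.OSAxiomsSchwinger
import Literature.MathematicalPhysics.QuantumFieldTheory.OSData
import Literature.MathematicalPhysics.QuantumFieldTheory.OSDistributionSpace

/-!
# Disproof of `DiagonalMirrorRPR` — standing adversary work file (cdisprove, cycle 3)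

Crux item `stmt-QuantumFields-10604`, decl `DiagonalMirrorRPR`, shared VERBATIM by the route files
`Theses/PencilRigidity.lean` (rank 5) and `Theses/MirrorModularBoosts.lean` (rank 4) (`shared_verbatim`).

**Verdict so far (cycles 1–3): NO KILL.**  The crux says: for every compact simple `G`, lattice
representation `r`, scheme `sch` and one-species family `S₁` carrying the curvature package `W₁`
(`CurvaturePackage`: lattice convergence of the renormalised action-density strings on `⁰𝒮`; E0, E0', E2(e₀),
E3, E4; translations + proper signed permutations on `⁰𝒮`; continuum gap + uniform lattice gap), `S₁` is
reflection positive in pull-back form for the four diagonal frames `R e₀ = (±e₀ ± e₁)/√2` (`DiagonalFrameRP`).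

## Findings index (prose only in doc-strings; every `theorem` below is checked, no `sorry`)

1. `crux_iff`, `shared_verbatim` (§1): the crux is definitionally `∀ G …, CurvaturePackage → DiagonalFrameRP`.
2. NO JUNK WITNESS (why cheap counterexamples do not exist). Every value the conclusion inspects is pinned by
   `W₁`: degree `0` by E0; degree `n ≥ 1` only on `linActMulti R (θFᵢ* ⊗ Fⱼ)`, whose support has pairwise
   distinct `R e₀`-times, hence lies off the coincidence locus, where off-diagonal real tensors are total and
   `hconv` fixes `S₁ n` by continuity. So the crux is equivalent to "every Wilson scheme whose curvature
   strings converge on `⁰𝒮` to a package-carrying family with a uniform lattice gap has a diagonally-RP limit";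
   a counterexample needs a GENUINE, controlled, non-ultralocal 4D non-abelian Wilson continuum limit.
3. COMPUTABLE SCHEMES SATISFY THE CONCLUSION (§2–§3): `c ≡ 0` gives the vacuum family (non-vacuity of the
   hypotheses, `cruxHypotheses_inhabited_and_conclusion_holds`, every `G`, `r`); `β ≡ 0` with arbitrary
   `c_k, m_k` gives constant-field limits `S₁ n F = κⁿ ∫ F` on `⁰𝒮` (lex-minimal-vertex argument, doc of
   `constField`), and `diagonalFrameRP_constField` PROVES the conclusion for every constant field `κ ∈ ℝ` in
   every frame; fixed / slowly moving strong coupling gives ultralocal limits = constant fields on `⁰𝒮`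
   (`Literature.Barriers.QuantumFields.FixedCouplingUltralocality`).
4. LOAD-BEARING, PROVED HERE (§6 statement, §8 proof, axioms `propext/Classical.choice/Quot.sound`):
   `Phantom.cruxWithoutLatticeConvergence_false : ¬ CruxWithoutLatticeConvergence` — the crux with `hconv`
   deleted (everything else of `W₁` kept) is FALSE. Witness `Phantom.phantomFamily = vacuum + T₃`, `T₃` the
   `W(B₄) × S₃`-average of Lebesgue integration over the 8-plane `V = Ψ(ℝ⁸) ⊂ 𝒩 = {3-point configurations in
   which every axis carries a coincidence}`: every e₀-based clause (hermiticity, E2, E4, `HasMassGap`) tests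
   only time-separated functions, on which `T₃` vanishes (`T₃_eq_zero_of_timeSep`), so the phantom carries
   `W₁ ∖ hconv` (`packageWithoutConvergence_phantomFamily`, every `G`, `r`, zero scheme); but the diagonal
   frame `R e₀ = (e₀+e₁)/√2` sees `V` (frame times `−2a, 2a, 6a`) and E2 there fails
   (`not_diagonalFrameRP_phantomFamily`: `z = −T₃(G_A) − T₃(G_B)`, `Re T₃(G_A) ≥ Re I(G_A) > 0`). MORAL: any
   proof must use `hconv`, in degrees `≥ 3`, on `𝒩`, where nothing else in `W₁` speaks. E0: the first
   filing `DiagonalMirrorRP` (no E0, no E2(e₀)) is refuted in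
   `Theorems/MirrorModularBoostsDiagonalMirrorRPRefutation.lean`; with E2(e₀) present no E0-free
   counterexample is known. Possibly unnecessary for TRUTH but used by the intended proof:
   `HasLatticeMassGap` (b.c.-insensitivity), E0', E3, E4, hermiticity, continuum gap.
5. THE STATEMENT'S OWN TORI ARE NOT SWAP-RP (§4): square periodic tori of either parity carry ONE genuine
   swap mirror (the far line is a glide: `swap_fixed_iff`, `oddTorus_far_line_glide`,
   `evenTorus_far_line_glide`); exact certificate `ising3_swap_pairing_neg` (= ℤ₂ lattice gauge theory on the
   `3×3×1` torus through its Polyakov spins, doc there). Diagonally-RP cut-offs are 45°-tilted tori / free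
   swap-symmetric boxes (FILS II §3). Hence TorusFreeInsensitivity is load-bearing for the intended proof.
6. HOLES IN THE INTENDED PROOF THAT ARE NOT COUNTEREXAMPLES (§5): (a) `β_k ≥ 0` is not assumed while the
   diagonal-cut plaquette weight is cone-positive only for `β ≥ 0` (`twoSpin_pairing_neg_of_neg`; for
   `SU(2)` the character coefficient of spin ½ in `exp((β/2) tr g)` is `4 I₂(β)/β < 0` for `β < 0`);
   (b) NEW (cycle 2): "uniform lattice gap ⇒ torus ≈ free box for local correlators" is FALSE as an abstract
   lattice principle — at a first-order bulk transition there is a window `L^{-d} ≪ β_k − β_t ≪ L^{-1}` in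
   which periodic tori sit in the ordered phase and free boxes in the disordered one while symmetric
   observables cluster exponentially in both (Borgs–Kotecký, J. Stat. Phys. 61 (1990): periodic rounding /
   shift `O(L^{-d})`; Borgs–Kotecký–Medved', J. Stat. Phys. 109 (2002), Thms 2.1, 2.3: with weak / free b.c.
   "the shift is typically of order `L^{-1}`, due to the contribution of the surface free energies", free b.c.
   "strongly enforces the disordered phase", `β_max^{(λ)}(L) = β_t[1 + (d/Δe)(½ − λ + …) L^{-1} + O(L^{-2})]`);
   the repair is to compare the statement's odd tori with 45°-TILTED TORI (also boundaryless, same bulk phase),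
   not with free boxes; (c) limit bookkeeping (density of off-diagonal real
   tensors in rotated wedge classes: spread the arguments apart by `xᵢ ↦ xᵢ + iT·Re₀`, cut off, box-Fourier).
7. NATURAL STRENGTHENINGS THAT ARE FALSE: swap-RP torus by torus (item 5); dropping `hconv` (item 4, proved §8);
   "axis RP ×4 + `W(B₄)` + gap (+ honest RP lattice scaling limit with uniform lattice gap) ⇒ diagonal RP" at the
   TWO-POINT level (item 8, §9).
8. NEW (cycle 3, §9) DIAGONAL RP IS ACTION-SPECIFIC: the ℓ¹-Gaussian `C(x) = e^{-m‖x‖₁}` (lattice: `2^{-‖x−y‖₁}`,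
   precision `⊗_μ` tridiagonal, site-RP across all four axis planes, uniform gap `m`, `a`-independent covariance on
   physical points, `W(B₄)`-invariant) is NOT diagonally RP: exact 3-point certificate in the open quadrant
   `{x₀ > 0 > x₁}`, form `= −7/128` (`L1Kernel.not_kernelRP_l1_diag`, `…_quadrant`), while axis RP holds on every
   configuration (`L1Kernel.kernelRP_l1_axis`, Gram identity of the AR(1) kernel; witness axis form `241/16384`). So no
   model-blind / volume-blind argument from the package can give the conclusion; the proof must use the diagonal
   Schur cut of Wilson's plaquette action (`β ≥ 0`) on a tilted geometry and transport it.
9. CYCLE-3 REGIME SWEEP (no scheme escapes ultralocality under rigorous control): amplification `c_k → ∞` against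
   strong-coupling decay `e^{-m(β)δ/a_k}` cannot converge for all separations `δ > 0` at once (hconv quantifies over
   all off-diagonal tensors), so bounded-`β` limits are constant on `⁰𝒮` whatever `c_k, m_k`; the super-weak regime
   `β_k ≫ log(1/a_k)` (near-Gaussian gluons, `c_k = β_k a_k^{-4}` would give the free `:F²:` limit) is excluded by
   `HasLatticeMassGap` (power-law decay at fixed `k` as `S → ∞`); critical endpoints of bulk first-order lines
   (mixed actions = reducible `ρ`, e.g. fundamental ⊕ adjoint; `SO(3)`; large `N`) and `β_k → −∞` (for `SU(2)` on
   the statement's ODD tori negative coupling is positive coupling with the maximal 't Hooft twist `n_μν ≡ 1`, class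
   `S² ≡ 1 mod 2` per coordinate 2-torus — exact parity lemma `OddTorusTwist.odd_torus_not_fully_frustrated`, §10,
   vs `even_torus_fully_frustrated`; for `SU(3)` a genuinely different, uncontrolled model) are the only
   places a non-ultralocal limit could live — none is under rigorous control, and universality predicts `O(4)`
   restoration (hence diagonal RP) at each.

## Landed through the gate (Theorems/DiagonalMirrorRPR/Negative/, importable)
`SquareTorusNotSwapRP` (p71699: §4 here), `InfiniteCouplingSlice` (p71736: §2–§3 here), `PhantomFunctional`
(p72030: §8.1–8.4 here), `PhantomFamily` (p72135: §8.5 here), `HconvLoadBearing` (p72850: §8.6 —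
`Phantom.phantomFamily_package_without_convergence`, `Phantom.exists_diagonalFrame_not_isReflectionPositive_phantomFamily`),
`L1GaussianNotDiagonalRP` (p73789, cycle 3: §9 here — `L1Kernel.kernelRP_l1_axis`, `L1Kernel.not_kernelRP_l1_diag`,
`L1Kernel.not_kernelRP_l1_quadrant`), `OddTorusTwist` (p75087, cycle 3: §10 here).
Ideators / planners / the lead may `import Summits.QuantumFields.YangMills.Theorems.DiagonalMirrorRPR.Negative.HconvLoadBearing`
(resp. `…Negative.L1GaussianNotDiagonalRP`).
This work file keeps its own copies (namespace `…Cruxes.DiagonalMirrorRPR.Disproof`) as the standing record.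

## For provers / planners (one paragraph)
Any proof must use `hconv` ON `𝒩` (degrees ≥ 3), i.e. go through the lattice; diagonal RP is exact on tilted
tori / free swap-symmetric boxes for `β ≥ 0` (plaquettes cut along their diagonal: `U_p = P₊(θP₊)†`,
`exp((β/N) Re tr(g h†))` Schur-positive); the whole difficulty is the transport to the statement's odd
periodic tori at physical scale. Recommend adding `∀ᶠ k, 0 ≤ sch.β k` to `W₁` if `SU(N ≥ 3)` matters.
-/

noncomputable section

open scoped SchwartzMap ComplexConjugate InnerProductSpace
open MeasureTheory Filter Topology Complex
open Literature.MathematicalPhysics.QuantumLattice Literature.MathematicalPhysics.AQFT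
  Literature.MathematicalPhysics.QuantumFieldTheory

namespace Summit.QuantumFields.YangMills.Cruxes.DiagonalMirrorRPR.Disproof

/-! ## §1 Readback: the crux is `CurvaturePackage → DiagonalFrameRP` -/

/-- Euclidean `ℝ⁴`, time = coordinate `0`. [folklore] -/
abbrev E4 : Type := EuclideanSpace ℝ (Fin 4)

section Package

variable {G : Type} [Group G] [TopologicalSpace G] [IsTopologicalGroup G] [CompactSpace G]
  [MeasurableSpace G] [BorelSpace G]

/-- The curvature-channel package `W₁ r sch S₁` of the crux, verbatim: lattice convergence of the
renormalised action-density strings on off-diagonal real tensors (`hconv`), the OS package E0/E0'/E2/E3/E4 of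
`S₁.toLabelled`, translation and proper-signed-permutation invariance on `⁰𝒮`, and a common continuum /
uniform lattice gap `Δ > 0`. [folklore] -/
def CurvaturePackage (r : LatticeRep G) (sch : SpeciesScheme (YMSpecies G)) (S₁ : SchwingerFamily E4) : Prop :=
  (∀ (n : ℕ), n ≠ 0 → ∀ (f : Fin n → 𝓢(E4, ℝ)) (F : 𝓢((Fin n → E4), ℂ)),
      IsTensorOf F (fun i => ofRealTest (f i)) → IsOffDiagonal F →
        Tendsto (fun k : ℕ => ((latticeSchwinger r.ρ sch (fun s => s.F) k n (fun _ => r.curvature) f : ℝ) : ℂ))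
          atTop (𝓝 (S₁ n F))) ∧
  (S₁.toLabelled.IsNormalized ∧ S₁.toLabelled.IsHermitian ∧ S₁.toLabelled.HasLinearGrowth ∧
    S₁.toLabelled.IsReflectionPositive ∧ S₁.toLabelled.IsSymmetric ∧ S₁.toLabelled.HasClusterProperty) ∧
  (∀ (n : ℕ) (a : E4) (F : 𝓢((Fin n → E4), ℂ)), IsOffDiagonal F → S₁ n (translateMulti a F) = S₁ n F) ∧
  (∀ (R : E4 ≃ₗᵢ[ℝ] E4), LinearMap.det (R.toLinearEquiv : E4 →ₗ[ℝ] E4) = 1 →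
    (∀ i : Fin 4, ∃ j : Fin 4, R (EuclideanSpace.single i 1) = EuclideanSpace.single j 1 ∨
      R (EuclideanSpace.single i 1) = -EuclideanSpace.single j 1) →
    ∀ (n : ℕ) (F : 𝓢((Fin n → E4), ℂ)), IsOffDiagonal F → S₁ n (linActMulti R F) = S₁ n F) ∧
  (∃ Δ : ℝ, 0 < Δ ∧ S₁.toLabelled.HasMassGap Δ ∧ HasLatticeMassGap r sch Δ)

end Package

/-- The conclusion of the crux for a one-species family: reflection positivity in pull-back form for every
frame `R` with `R e₀ = a e₀ + b e₁`, `a² = b² = 1/2` (RP across the mirror `(R e₀)^⊥`, i.e. one of the four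
oriented diagonal mirrors `x₀ = ± x₁`; depends on `R` only through `R e₀`). [folklore] -/
def DiagonalFrameRP (S₁ : SchwingerFamily E4) : Prop :=
  ∀ (R : E4 ≃ₗᵢ[ℝ] E4) (a b : ℝ), a ^ 2 = 1 / 2 → b ^ 2 = 1 / 2 →
    R (EuclideanSpace.single 0 1) = a • EuclideanSpace.single 0 1 + b • EuclideanSpace.single 1 1 →
      (SchwingerFamily.toLabelled (fun n => (S₁ n).comp (linActMulti R))).IsReflectionPositive

/-- **The two route copies are the same proposition** (one proof / one refutation serves both routes). [folklore] -/
theorem shared_verbatim :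
    Summit.QuantumFields.YangMills.Theses.PencilRigidity.DiagonalMirrorRPR ↔
      Summit.QuantumFields.YangMills.Theses.MirrorModularBoosts.DiagonalMirrorRPR := Iff.rfl

/-- **Readback.** The crux is, definitionally, "`CurvaturePackage r sch S₁ → DiagonalFrameRP S₁` for every
compact simple `G` (Borel σ-algebra), every `r`, `sch`, `S₁`". [folklore] -/
theorem crux_iff :
    Summit.QuantumFields.YangMills.Theses.PencilRigidity.DiagonalMirrorRPR ↔
      ∀ (G : Type) [Group G] [TopologicalSpace G] [IsTopologicalGroup G] [CompactSpace G],
        IsCompactSimpleLieGroup G →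
          letI : MeasurableSpace G := borel G
          haveI : BorelSpace G := ⟨rfl⟩
          ∀ (r : LatticeRep G) (sch : SpeciesScheme (YMSpecies G)) (S₁ : SchwingerFamily E4),
            CurvaturePackage r sch S₁ → DiagonalFrameRP S₁ :=
  Iff.rfl


/-! ## §2 Non-vacuity: the hypotheses are inhabited and the conclusion holds at the inhabitant

The degenerate data `c ≡ 0` (all lattice fields vanish) with `β ≡ 0` (Haar product measure: bond-disjoint
observables are independent, so the uniform lattice gap holds for EVERY rate) and the vacuum family
`𝔖₀ = 1, 𝔖ₙ = 0 (n ≥ 1)` inhabit `CurvaturePackage` for every `G`, `r`; the vacuum family is diagonally RP.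
So the crux is not vacuously true, and its conclusion is consistent with its hypotheses. -/

section NonVacuity

variable {G : Type} [Group G] [TopologicalSpace G] [IsTopologicalGroup G] [CompactSpace G]
  [MeasurableSpace G] [BorelSpace G]

/-- Eventually `M ≤ L_k` along any scheme (`a_k → 0` and `a_k L_k → ∞` force `L_k → ∞`). [folklore] -/
theorem eventually_le_schemeL {ι : Type} (sch : SpeciesScheme ι) (M : ℕ) :
    ∀ᶠ k in atTop, M ≤ sch.L k := by
  have ha : ∀ᶠ k in atTop, sch.a k ≤ 1 :=
    (sch.tendsto_a.eventually (gt_mem_nhds (by norm_num : (0 : ℝ) < 1))).mono fun k hk => hk.le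
  have hL : ∀ᶠ k in atTop, (M : ℝ) ≤ sch.a k * sch.L k := sch.tendsto_L.eventually (eventually_ge_atTop _)
  filter_upwards [ha, hL] with k hak hLk
  have hpos := sch.a_pos k
  have h1 : sch.a k * sch.L k ≤ sch.L k := by
    have := mul_le_of_le_one_left (Nat.cast_nonneg (sch.L k)) hak
    simpa using this
  exact_mod_cast hLk.trans h1

/-- **Uniform lattice gap at `β ≡ 0`, every rate.** If the scheme's couplings vanish, the torus Wilson
measure is the Haar product; two gauge-invariant local observables at time separation beyond the sum of
their support diameters are independent (transfer to `ℤ⁴`, `integral_mul_of_dependsOn`), so the connected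
correlation VANISHES there, and the finitely many short separations are absorbed in the constant. Hence
`HasLatticeMassGap r sch Δ` for every real `Δ` — the clause has no force at infinite coupling. [folklore] -/
theorem hasLatticeMassGap_of_beta_eq_zero (r : LatticeRep G) (sch : SpeciesScheme (YMSpecies G))
    (hβ : ∀ k, sch.β k = 0) (Δ : ℝ) : HasLatticeMassGap r sch Δ := by
  intro A B
  classical
  obtain ⟨MA, hMA⟩ := A.bounded
  obtain ⟨MB, hMB⟩ := B.bounded
  have hMA0 : 0 ≤ MA := (abs_nonneg _).trans (hMA fun _ => 1)
  have hMB0 : 0 ≤ MB := (abs_nonneg _).trans (hMB fun _ => 1)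
  -- the finitely many time separations with overlapping supports, and a radius for the supports
  let D : Finset ℤ := (A.supp ×ˢ B.supp).image fun p => (p.1.1 - p.2.1) 0
  let N₀ : ℕ := D.sum (fun z => z.natAbs) + 1
  let Rad : ℕ := (A.supp ∪ B.supp).sum fun e => ∑ i, (e.1 i).natAbs
  have hRad : ∀ e ∈ A.supp ∪ B.supp, ∀ i, |e.1 i| ≤ Rad := by
    intro e he i
    have h1 : (e.1 i).natAbs ≤ ∑ j, (e.1 j).natAbs :=
      Finset.single_le_sum (f := fun j => (e.1 j).natAbs) (fun _ _ => Nat.zero_le _) (Finset.mem_univ i)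
    have h2 : ∑ j, (e.1 j).natAbs ≤ Rad :=
      Finset.single_le_sum (f := fun e => ∑ j, (e.1 j).natAbs) (fun _ _ => Nat.zero_le _) he
    rw [Int.abs_eq_natAbs]
    exact_mod_cast h1.trans h2
  have ha1 : ∀ᶠ k in atTop, sch.a k ≤ 1 :=
    (sch.tendsto_a.eventually (gt_mem_nhds (by norm_num : (0 : ℝ) < 1))).mono fun k hk => hk.le
  refine ⟨2 * MA * MB * Real.exp (|Δ| * N₀) + 1, ?_⟩
  filter_upwards [eventually_le_schemeL sch (2 * Rad), ha1] with k hk hak S hS n hn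
  have hRS : 2 * Rad ≤ S := hk.trans hS
  rw [hβ k]
  show |latticeConnectedCorr r.ρ 0 (2 * S + 1) A.F B.F n| ≤
    (2 * MA * MB * Real.exp (|Δ| * N₀) + 1) * Real.exp (-(Δ * (sch.a k * n)))
  have hC0 : 0 ≤ 2 * MA * MB * Real.exp (|Δ| * N₀) + 1 := by positivity
  by_cases hnN : n < N₀
  · -- overlapping supports: the crude bound `2 M_A M_B`
    have e1 := abs_wilsonExpectation_le_of_abs_le (L := 2 * S + 1) r.ρ r.continuous 0
      (F := fun U => A.F (torusLift (2 * S + 1) U) *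
        B.F (configShift (-Pi.single 0 (n : ℤ)) (torusLift (2 * S + 1) U)))
      (C := MA * MB) fun U => by
        rw [abs_mul]; exact mul_le_mul (hMA _) (hMB _) (abs_nonneg _) hMA0
    have e2 := abs_wilsonExpectation_le_of_abs_le (L := 2 * S + 1) r.ρ r.continuous 0
      (F := fun U => A.F (torusLift (2 * S + 1) U)) (C := MA) fun U => hMA _
    have e3 := abs_wilsonExpectation_le_of_abs_le (L := 2 * S + 1) r.ρ r.continuous 0
      (F := fun U => B.F (torusLift (2 * S + 1) U)) (C := MB) fun U => hMB _
    simp only [wilsonExpectation] at e1 e2 e3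
    have hcorr : |latticeConnectedCorr r.ρ 0 (2 * S + 1) A.F B.F n| ≤ 2 * MA * MB := by
      unfold latticeConnectedCorr
      calc _ ≤ _ := abs_sub _ _
        _ ≤ MA * MB + MA * MB :=
          add_le_add e1 (by rw [abs_mul]; exact mul_le_mul e2 e3 (abs_nonneg _) hMA0)
        _ = 2 * MA * MB := by ring
    have hexp : Real.exp (-(|Δ| * N₀)) ≤ Real.exp (-(Δ * (sch.a k * n))) := by
      apply Real.exp_le_exp.2
      have hn0 : (0 : ℝ) ≤ n := Nat.cast_nonneg n
      have hnN' : (n : ℝ) ≤ N₀ := by exact_mod_cast hnN.le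
      have hak0 : 0 ≤ sch.a k := (sch.a_pos k).le
      have h1 : Δ * (sch.a k * n) ≤ |Δ| * (sch.a k * n) :=
        mul_le_mul_of_nonneg_right (le_abs_self Δ) (mul_nonneg hak0 hn0)
      have h2 : |Δ| * (sch.a k * n) ≤ |Δ| * N₀ := by
        refine mul_le_mul_of_nonneg_left ?_ (abs_nonneg Δ)
        calc sch.a k * n ≤ 1 * n := mul_le_mul_of_nonneg_right hak hn0
          _ = n := one_mul _
          _ ≤ N₀ := hnN'
      linarith
    calc |latticeConnectedCorr r.ρ 0 (2 * S + 1) A.F B.F n| ≤ 2 * MA * MB := hcorr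
      _ = (2 * MA * MB * Real.exp (|Δ| * N₀)) * Real.exp (-(|Δ| * N₀)) := by
          rw [mul_assoc (2 * MA * MB), ← Real.exp_add, add_neg_cancel, Real.exp_zero, mul_one]
      _ ≤ (2 * MA * MB * Real.exp (|Δ| * N₀) + 1) * Real.exp (-(|Δ| * N₀)) := by
          gcongr; linarith
      _ ≤ (2 * MA * MB * Real.exp (|Δ| * N₀) + 1) * Real.exp (-(Δ * (sch.a k * n))) :=
          mul_le_mul_of_nonneg_left hexp hC0
  · -- disjoint supports: at `β = 0` the connected correlation vanishes
    have hnN' : N₀ ≤ n := not_lt.1 hnN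
    suffices hzero : latticeConnectedCorr r.ρ 0 (2 * S + 1) A.F B.F n = 0 by
      rw [hzero, abs_zero]; positivity
    unfold latticeConnectedCorr
    set v : Literature.Probability.LatticeModels.Site 4 := -Pi.single 0 (n : ℤ) with hv
    let T := B.supp.image fun e => (e.1 - v, e.2)
    have hB' : IsCylinder (fun U => B.F (configShift v U)) T := IsCylinder.comp_configShift B.isCylinder v
    have hAB : IsCylinder (fun U => A.F U * B.F (configShift v U)) (A.supp ∪ T) :=
      IsCylinder.mul A.isCylinder hB'
    have hslab : ∀ e ∈ A.supp ∪ T, ∀ i, -(Rad : ℤ) ≤ e.1 i ∧ e.1 i ≤ Rad + n := by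
      intro e he i
      rcases Finset.mem_union.1 he with heA | heT
      · have h := abs_le.1 (hRad e (Finset.mem_union_left _ heA) i)
        exact ⟨h.1, h.2.trans (by omega)⟩
      · obtain ⟨b', hb', rfl⟩ := Finset.mem_image.1 heT
        have h := abs_le.1 (hRad b' (Finset.mem_union_right _ hb') i)
        have hsingle : (0 : ℤ) ≤ Pi.single (M := fun _ : Fin 4 => ℤ) 0 (n : ℤ) i ∧
            Pi.single (M := fun _ : Fin 4 => ℤ) 0 (n : ℤ) i ≤ n := by
          by_cases hi : i = 0
          · subst hi; simp
          · simp [hi]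
        simp only [hv, Pi.sub_apply, Pi.neg_apply, sub_neg_eq_add]
        exact ⟨by omega, by omega⟩
    have hinj : Set.InjOn (torusEdge (d := 4) (2 * S + 1)) ↑(A.supp ∪ T) := by
      intro e he e' he' hee'
      simp only [torusEdge, Prod.mk.injEq] at hee'
      refine Prod.ext (funext fun i => ?_) hee'.2
      have hk : ((e.1 i : ℤ) : ZMod (2 * S + 1)) = ((e'.1 i : ℤ) : ZMod (2 * S + 1)) := by
        have := congrFun hee'.1 i
        simpa [Literature.Probability.LatticeModels.Torus.proj_apply] using this
      have hdvd := (ZMod.intCast_eq_intCast_iff_dvd_sub _ _ _).1 hk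
      obtain ⟨lo, hi⟩ := hslab e he i
      obtain ⟨lo', hi'⟩ := hslab e' he' i
      have hlt : |e'.1 i - e.1 i| < ((2 * S + 1 : ℕ) : ℤ) := by
        rw [abs_lt]; push_cast; constructor <;> omega
      have h0 := Int.eq_zero_of_abs_lt_dvd hdvd hlt
      omega
    have hdisj : Disjoint A.supp T := by
      rw [Finset.disjoint_left]
      intro e heA heT
      obtain ⟨b', hb', hbe⟩ := Finset.mem_image.1 heT
      have hmem : (n : ℤ) ∈ D := by
        refine Finset.mem_image.2 ⟨(e, b'), Finset.mem_product.2 ⟨heA, hb'⟩, ?_⟩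
        rw [← hbe]
        simp [hv]
      have hle : (n : ℤ).natAbs ≤ D.sum fun z => z.natAbs :=
        Finset.single_le_sum (f := fun z : ℤ => z.natAbs) (fun _ _ => Nat.zero_le _) hmem
      simp only [Int.natAbs_natCast] at hle
      omega
    have hW0 : wilsonMeasure (d := 4) (L := 2 * S + 1) r.ρ 0 = Measure.pi fun _ => haarProbability G := by
      have h1 : wilsonWeight (d := 4) (L := 2 * S + 1) r.ρ 0 = Measure.pi fun _ => haarProbability G := by
        unfold wilsonWeight
        simp only [neg_zero, zero_mul, Real.exp_zero, ENNReal.ofReal_one]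
        exact withDensity_one
      unfold wilsonMeasure partitionFunction
      rw [h1, measure_univ, inv_one, one_smul]
    have tA := integral_torusLift_eq_integral_zdHaar (L := 2 * S + 1) (F := A.F)
      (hinj.mono (Finset.coe_subset.2 Finset.subset_union_left)) A.measurable A.isCylinder
    have tB := integral_torusLift_eq_integral_zdHaar (L := 2 * S + 1)
      (F := fun U => B.F (configShift v U))
      (hinj.mono (Finset.coe_subset.2 Finset.subset_union_right))
      (B.measurable.comp (configShift v).measurable) hB'
    have tAB := integral_torusLift_eq_integral_zdHaar (L := 2 * S + 1)
      (F := fun U => A.F U * B.F (configShift v U)) hinj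
      (A.measurable.mul (B.measurable.comp (configShift v).measurable)) hAB
    have hind := integral_mul_of_dependsOn (G := G)
      (g := fun U => (A.F U : ℂ)) (h := fun U => (B.F (configShift v U) : ℂ)) hdisj
      (Complex.measurable_ofReal.comp A.measurable)
      (Complex.measurable_ofReal.comp (B.measurable.comp (configShift v).measurable))
      (fun U V hUV => by simp only [A.isCylinder hUV]) (fun U V hUV => by simp only [hB' hUV])
    have hreal : ∫ U, A.F U * B.F (configShift v U) ∂(zdHaar 4 G) =
        (∫ U, A.F U ∂(zdHaar 4 G)) * ∫ U, B.F (configShift v U) ∂(zdHaar 4 G) := by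
      apply Complex.ofReal_injective
      rw [Complex.ofReal_mul, ← integral_complex_ofReal, ← integral_complex_ofReal,
        ← integral_complex_ofReal]
      simp only [Complex.ofReal_mul]
      exact hind
    have hZ : ∫ U, B.F (torusLift (2 * S + 1) U) ∂(wilsonMeasure (d := 4) (L := 2 * S + 1) r.ρ 0) =
        ∫ U, B.F (configShift v (torusLift (2 * S + 1) U))
          ∂(wilsonMeasure (d := 4) (L := 2 * S + 1) r.ρ 0) := by
      have ht := wilsonExpectation_comp_torusConfigShift (ρ := r.ρ) (L := 2 * S + 1) 0
        (Literature.Probability.LatticeModels.Torus.proj (2 * S + 1) v) (toTorusObservable (2 * S + 1) B.F)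
      rw [← toTorusObservable_comp_configShift] at ht
      simp only [wilsonExpectation, toTorusObservable_apply, Function.comp_apply] at ht
      exact ht.symm
    rw [hZ, hW0, tAB, tA, tB, hreal, sub_self]

/-- The vacuum-only one-species family `𝔖₀ = 1`, `𝔖ₙ = 0` (`n ≥ 1`). [folklore] -/
def vacuumFamily : SchwingerFamily E4 := fun n => LabelledSchwingerFamily.trivial Unit E4 n fun _ => ()

/-- Its labelled version is the tree's vacuum-only labelled family. [folklore] -/
theorem vacuumFamily_toLabelled : vacuumFamily.toLabelled = LabelledSchwingerFamily.trivial Unit E4 := by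
  funext n k
  rw [SchwingerFamily.toLabelled_apply, Subsingleton.elim k fun _ => ()]
  rfl

/-- Pulling the vacuum family back along any linear isometry gives the vacuum family again. [folklore] -/
theorem vacuumFamily_pullback (R : E4 ≃ₗᵢ[ℝ] E4) :
    (SchwingerFamily.toLabelled fun n => (vacuumFamily n).comp (linActMulti R)) =
      LabelledSchwingerFamily.trivial Unit E4 := by
  funext n k
  rw [SchwingerFamily.toLabelled_apply]
  ext F
  rw [ContinuousLinearMap.comp_apply]
  show LabelledSchwingerFamily.trivial Unit E4 n (fun _ => ()) (linActMulti R F) =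
    LabelledSchwingerFamily.trivial Unit E4 n k F
  rcases Nat.eq_zero_or_pos n with rfl | hn
  · rw [LabelledSchwingerFamily.trivial_zero_apply _ _ _ 0, LabelledSchwingerFamily.trivial_zero_apply _ _ _ 0,
      linActMulti_apply]
    congr 1
    exact Subsingleton.elim _ _
  · simp [LabelledSchwingerFamily.trivial_of_ne_zero _ hn.ne']

/-- **The conclusion holds at the vacuum family, in every frame.** [folklore] -/
theorem diagonalFrameRP_vacuumFamily : DiagonalFrameRP vacuumFamily := by
  intro R _ _ _ _ _
  rw [vacuumFamily_pullback]
  exact (OSAxiomsSchwinger.trivial (ι := Unit) (d := 4)).reflectionPositive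

/-- At `c ≡ 0` every lattice `n`-point function with `n ≠ 0` vanishes. [folklore] -/
theorem latticeSchwinger_eq_zero_of_c_eq_zero {N : ℕ} (ρ : G →* Matrix (Fin N) (Fin N) ℂ)
    (sch : SpeciesScheme (YMSpecies G)) (hc : ∀ s k, sch.c s k = 0) (k : ℕ) {n : ℕ} (hn : n ≠ 0)
    (σ : Fin n → YMSpecies G) (f : Fin n → 𝓢(E4, ℝ)) :
    latticeSchwinger ρ sch (fun s => s.F) k n σ f = 0 := by
  obtain ⟨j, rfl⟩ := Nat.exists_eq_succ_of_ne_zero hn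
  simp [latticeSchwinger, smearedLatticeField, hc]

/-- **The hypotheses are inhabited by the degenerate data**: any scheme with `c ≡ 0` and `β ≡ 0` (e.g.
`SpeciesScheme.zero`), any `r`, and the vacuum family carry the whole package `W₁`. [folklore] -/
theorem curvaturePackage_vacuum (r : LatticeRep G) (sch : SpeciesScheme (YMSpecies G))
    (hc : ∀ s k, sch.c s k = 0) (hβ : ∀ k, sch.β k = 0) : CurvaturePackage r sch vacuumFamily := by
  have hOS : OSAxiomsSchwinger vacuumFamily.toLabelled := by
    rw [vacuumFamily_toLabelled]; exact OSAxiomsSchwinger.trivial Unit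
  refine ⟨?_, ⟨hOS.normalized, hOS.hermitian, hOS.linearGrowth, hOS.reflectionPositive, hOS.symmetric,
    hOS.cluster⟩, ?_, ?_, ⟨1, one_pos, ?_, hasLatticeMassGap_of_beta_eq_zero r sch hβ 1⟩⟩
  · intro n hn f F _ _
    have hS : vacuumFamily n F = 0 := by
      simp [vacuumFamily, LabelledSchwingerFamily.trivial_of_ne_zero _ hn]
    rw [hS]
    refine tendsto_const_nhds.congr' (Eventually.of_forall fun k => ?_)
    simp only [latticeSchwinger_eq_zero_of_c_eq_zero r.ρ sch hc k hn, Complex.ofReal_zero]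
  · intro n a F hF
    exact hOS.invariant.1 n (fun _ => ()) a F hF
  · intro R hR _ n F hF
    exact hOS.invariant.2 n (fun _ => ()) R hR F hF
  · rw [vacuumFamily_toLabelled]
    exact OSData.vacuum_hasMassGap (ι := Unit) (d := 4) 1

/-- **Non-vacuity of the crux (and consistency of its conclusion)**: `G = SU(2)` (compact simple by the
tree's fact `isSimpleCompactGroup_specialUnitaryGroup_holds`), the fundamental representation, the zero
scheme and the vacuum family satisfy `CurvaturePackage`, and `DiagonalFrameRP` holds there. So neither
"vacuously true" nor "false at the obvious inhabitant". [folklore] -/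
theorem cruxHypotheses_inhabited_and_conclusion_holds :
    ∃ (G : Type) (_ : Group G) (_ : TopologicalSpace G) (_ : IsTopologicalGroup G) (_ : CompactSpace G),
      IsCompactSimpleLieGroup G ∧
        letI : MeasurableSpace G := borel G
        haveI : BorelSpace G := ⟨rfl⟩
        ∃ (r : LatticeRep G) (sch : SpeciesScheme (YMSpecies G)) (S₁ : SchwingerFamily E4),
          CurvaturePackage r sch S₁ ∧ DiagonalFrameRP S₁ := by
  refine ⟨Matrix.specialUnitaryGroup (Fin 2) ℂ, inferInstance, inferInstance, inferInstance, inferInstance,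
    isCompactSimpleLieGroup_specialUnitaryGroup isSimpleCompactGroup_specialUnitaryGroup_holds le_rfl, ?_⟩
  letI : MeasurableSpace (Matrix.specialUnitaryGroup (Fin 2) ℂ) := borel _
  haveI : BorelSpace (Matrix.specialUnitaryGroup (Fin 2) ℂ) := ⟨rfl⟩
  exact ⟨⟨2, fundamentalRep (Fin 2), continuous_fundamentalRep _, fundamentalRep_injective _,
      fundamentalRep_mem_unitaryGroup⟩, SpeciesScheme.zero _, vacuumFamily,
    curvaturePackage_vacuum _ _ (fun _ _ => rfl) (fun _ => rfl), diagonalFrameRP_vacuumFamily⟩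

end NonVacuity

/-! ## §3 Constant fields satisfy the conclusion in every frame -/

section ConstField

variable {n m : ℕ}

/-- Lebesgue measure on `(ℝ⁴)ⁿ` has temperate growth (instance search does not find the add-Haar route
through the `PiLp` coordinates unaided). [folklore] -/
instance volume_pi_E4_hasTemperateGrowth (n : ℕ) : (volume : Measure (Fin n → E4)).HasTemperateGrowth :=
  Measure.IsAddHaarMeasure.instHasTemperateGrowth

/-- Lebesgue integration of an `n`-point test function, `F ↦ ∫ F`, as a continuous functional. [folklore] -/
def integ (n : ℕ) : 𝓢((Fin n → E4), ℂ) →L[ℂ] ℂ :=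
  SchwartzMap.integralCLM ℂ (volume : Measure (Fin n → E4))

/-- `integ n F = ∫ F`. [folklore] -/
theorem integ_apply (F : 𝓢((Fin n → E4), ℂ)) : integ n F = ∫ x, F x := by
  simp [integ]

/-- **The constant field `φ ≡ κ`**: `𝔖ₙ(F) = κⁿ ∫ F` (the law of the deterministic configuration `κ`;
the `β ≡ 0` continuum limits of the crux's lattice data on `⁰𝒮`, see the section doc). [folklore] -/
def constField (κ : ℝ) : SchwingerFamily E4 := fun n => ((κ : ℂ) ^ n) • integ n

/-- `constField κ n F = κⁿ ∫ F`. [folklore] -/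
theorem constField_apply (κ : ℝ) (F : 𝓢((Fin n → E4), ℂ)) :
    constField κ n F = (κ : ℂ) ^ n * ∫ x, F x := by
  simp [constField, integ_apply]

/-- The diagonal action of a linear isometry preserves Lebesgue measure on `(ℝ⁴)ⁿ`. [folklore] -/
theorem integral_linActMulti (R : E4 ≃ₗᵢ[ℝ] E4) (F : 𝓢((Fin n → E4), ℂ)) :
    ∫ x, linActMulti R F x = ∫ x, F x := by
  let e : (Fin n → E4) ≃ᵐ (Fin n → E4) :=
    MeasurableEquiv.piCongrRight fun _ => R.symm.toHomeomorph.toMeasurableEquiv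
  have he : MeasurePreserving e volume volume :=
    volume_preserving_pi fun _ => R.symm.measurePreserving
  exact he.integral_comp' (fun x => F x)

/-- Splitting `(ℝ⁴)^{n+m} = (ℝ⁴)ⁿ × (ℝ⁴)ᵐ` along `Fin.append`, as a measurable equivalence. [folklore] -/
def appendSplit (n m : ℕ) : (Fin (n + m) → E4) ≃ᵐ (Fin n → E4) × (Fin m → E4) :=
  (MeasurableEquiv.piCongrLeft (fun _ : Fin (n + m) => E4) finSumFinEquiv).symm.trans
    (MeasurableEquiv.sumPiEquivProdPi fun _ : Fin n ⊕ Fin m => E4)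

/-- `appendSplit` splits along `Fin.castAdd` / `Fin.natAdd`. [folklore] -/
theorem appendSplit_apply (x : Fin (n + m) → E4) :
    appendSplit n m x = (x ∘ Fin.castAdd m, x ∘ Fin.natAdd n) := rfl

/-- `appendSplit` preserves Lebesgue measure. [folklore] -/
theorem measurePreserving_appendSplit (n m : ℕ) :
    MeasurePreserving (appendSplit n m) volume volume :=
  ((volume_measurePreserving_piCongrLeft (fun _ : Fin (n + m) => E4) finSumFinEquiv).symm _).trans
    (volume_measurePreserving_sumPiEquivProdPi fun _ : Fin n ⊕ Fin m => E4)

/-- `∫ (A ⊗ B) = (∫ A)(∫ B)` for appended tensor products. [folklore] -/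
theorem integral_appendTensor {H : 𝓢((Fin (n + m) → E4), ℂ)} {A : 𝓢((Fin n → E4), ℂ)}
    {B : 𝓢((Fin m → E4), ℂ)} (hH : IsAppendTensorOf H A B) :
    ∫ x, H x = (∫ y, A y) * ∫ z, B z := by
  have h1 : (fun x => H x) = fun x => (fun p : (Fin n → E4) × (Fin m → E4) => A p.1 * B p.2) (appendSplit n m x) := by
    funext x; rw [hH x, appendSplit_apply]
  rw [h1]
  exact ((measurePreserving_appendSplit n m).integral_comp'
    (fun p : (Fin n → E4) × (Fin m → E4) => A p.1 * B p.2)).trans (integral_prod_mul _ _)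

/-- `∫ θF* = conj ∫ F`. [folklore] -/
theorem integral_osAdjoint (F : 𝓢((Fin n → E4), ℂ)) :
    ∫ x, osAdjoint F x = conj (∫ x, F x) := by
  let e₁ : (Fin n → E4) ≃ᵐ (Fin n → E4) := (MeasurableEquiv.piCongrLeft (fun _ : Fin n => E4) Fin.revPerm).symm
  let e₂ : (Fin n → E4) ≃ᵐ (Fin n → E4) :=
    MeasurableEquiv.piCongrRight fun _ => (timeReflection 4).toHomeomorph.toMeasurableEquiv
  have h₁ : MeasurePreserving e₁ volume volume :=
    (volume_measurePreserving_piCongrLeft (fun _ : Fin n => E4) Fin.revPerm).symm _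
  have h₂ : MeasurePreserving e₂ volume volume :=
    volume_preserving_pi fun _ => (timeReflection 4).measurePreserving
  have h12 : MeasurePreserving (e₁.trans e₂) volume volume := h₂.comp h₁
  have he : (fun x => osAdjoint F x) = fun x => conj (F ((e₁.trans e₂) x)) := by
    funext x
    rw [osAdjoint_apply]
    rfl
  rw [he, integral_conj, h12.integral_comp' (fun y => F y)]

/-- **Constant fields are reflection positive in every frame** (all linear isometries `R`, not only the
diagonal ones): `∑ᵢⱼ κ^{dᵢ+dⱼ} ∫ R·(θFᵢ* ⊗ Fⱼ) = |∑ⱼ κ^{dⱼ} ∫ Fⱼ|² ≥ 0`. In particular `DiagonalFrameRP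
(constField κ)`: the `β ≡ 0` slice of the hypothesis space (whatever the renormalisations `c_k, m_k`) cannot
refute the crux. [folklore] -/
theorem constField_pullback_isReflectionPositive (κ : ℝ) (R : E4 ≃ₗᵢ[ℝ] E4) :
    (SchwingerFamily.toLabelled (fun n => (constField κ n).comp (linActMulti R))).IsReflectionPositive := by
  intro N deg lab F hF H hH
  let c : Fin N → ℂ := fun j => (κ : ℂ) ^ deg j * ∫ x, F j x
  have hterm : ∀ i j, (SchwingerFamily.toLabelled (fun n => (constField κ n).comp (linActMulti R)))
      (deg i + deg j) (Fin.append (lab i ∘ Fin.rev) (lab j)) (H i j) = conj (c i) * c j := by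
    intro i j
    rw [SchwingerFamily.toLabelled_apply, ContinuousLinearMap.comp_apply, constField_apply,
      integral_linActMulti, integral_appendTensor (hH i j), integral_osAdjoint]
    simp only [c, map_mul, map_pow, Complex.conj_ofReal, pow_add]
    ring
  have hsum : ∑ i, ∑ j, conj (c i) * c j = conj (∑ i, c i) * ∑ j, c j := by
    rw [map_sum, Finset.sum_mul]
    refine Finset.sum_congr rfl fun i _ => ?_
    rw [Finset.mul_sum]
  simp only [hterm]
  rw [hsum, mul_comm, Complex.mul_conj, Complex.ofReal_re, Complex.ofReal_im]
  exact ⟨Complex.normSq_nonneg _, rfl⟩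

theorem diagonalFrameRP_constField (κ : ℝ) : DiagonalFrameRP (constField κ) :=
  fun R _ _ _ _ _ => constField_pullback_isReflectionPositive κ R

end ConstField

/-! ## §4 The statement's own tori are not swap-RP (finite certificates) -/

section SquareTori

/-- On the square torus `(ℤ/S)²` the swap `(x, y) ↦ (y, x)` fixes exactly the diagonal. [folklore] -/
theorem swap_fixed_iff {S : ℕ} (x y : ZMod S) : ((y, x) : ZMod S × ZMod S) = (x, y) ↔ x = y := by
  constructor
  · intro h; exact (Prod.mk.inj h).2
  · rintro rfl; rfl

/-- **Odd torus: the far cut is between the layers `u = L` and `u = L + 1`, which the swap EXCHANGES**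
(`u = x − y`; on `ℤ/(2L+1)`, `−L = L + 1`): no second mirror of sites, the would-be mirror `u = L + ½`
cuts the `(0,1)`-plaquettes through a corner, and its crossing links wind around the torus. [folklore] -/
theorem oddTorus_far_layers_swapped (L : ℕ) (x y : ZMod (2 * L + 1)) (h : x - y = L) :
    y - x = L + 1 := by
  have h2 : ((2 * L + 1 : ℕ) : ZMod (2 * L + 1)) = 0 := ZMod.natCast_self _
  push_cast at h2
  linear_combination (-1 : ZMod (2 * L + 1)) * h - h2

/-- **Even torus: the far line `u = L` is mapped to itself by the swap, but as the GLIDE `(x, y) ↦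
(x + L, y + L)`** (no fixed site for `L ≠ 0`): square tori of either parity have ONE genuine swap mirror,
so the FILS cone argument is unavailable on them (the swap-RP cut-offs are the 45°-tilted tori
`ℤ²/⟨(M,M),(N,−N)⟩` and free swap-symmetric boxes, FILS II §3). [folklore] -/
theorem evenTorus_far_line_glide (L : ℕ) (x y : ZMod (2 * L)) (h : x - y = L) :
    ((y, x) : ZMod (2 * L) × ZMod (2 * L)) = (x + L, y + L) := by
  have h2 : ((2 * L : ℕ) : ZMod (2 * L)) = 0 := ZMod.natCast_self _
  push_cast at h2
  refine Prod.ext ?_ ?_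
  · show y = x + L
    linear_combination (-1 : ZMod (2 * L)) * h - h2
  · show x = y + L
    linear_combination h

end SquareTori

/-! ### Exact certificate on the `3 × 3` torus

Nearest-neighbour Ising model on `(ℤ/3)²` with bond weights `2 + σσ'` (i.e. `e^{βσσ'}` up to a constant,
`tanh β = 1/2`), swap `θ(x,y) = (y,x)`, positive half `Λ₊ = {u = x − y = 1}`, negative half `Λ₋ = {u = 2}`,
mirror `{u = 0}`. The real observable `F = 2σ(1,0) − σ(2,1) − σ(0,2)` is supported in `Λ₊`, `θF = F ∘ θ` in
`Λ₋`, and `∑_σ w(σ) F(σ) (θF)(σ) = −67184640 < 0`: the torus Gibbs state is NOT reflection positive for the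
swap (whereas it is RP for the axis reflections, FILS I). GAUGE READING: on the `3×3×1` torus the ℤ₂ lattice
gauge theory with Wilson weight `∏ₚ(2 + U_p)` factorises into the planar gauge field and an Ising model in the
gauge-invariant Polyakov spins `V_x = U_{(x,e₂)}` (the `(0,2)`/`(1,2)` plaquettes are `V_x V_{x+e₀}`,
`V_x V_{x+e₁}` since `x + e₂ = x`), so the same number, times the positive planar partition function, is the
swap pairing of the Polyakov-loop observable `2V(1,0) − V(2,1) − V(0,2)` in a genuine lattice gauge theory.
(Cycle 1 also certified the `4 × 4` torus: weights `5 + σσ'`, `F = σ(1,0)σ(2,1) − σ(1,0)σ(0,3) − σ(2,1)σ(3,2)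
+ σ(3,2)σ(0,3)` at level `u = 1`, pairing `−32605077635079717519360000`; and a ℤ₂ gauge `3×3×2` torus by an
exact computer-algebra job. Numbers re-verified in cycle 2 by brute force, `scratch/ising3.py`, `ising4.py`, and
again in cycle 3 (`4×4`, weights `5 + σσ'`: `−32605077635079717519360000`; weights `2 + σσ'`:
`−54707431145472`); a kernel `decide` over the `2¹⁶` configurations of the EVEN `4×4` torus exceeds ten minutes
on the farm and is therefore not included — the even case rests on `evenTorus_far_line_glide` + these numbers.)
-/

namespace Ising3

/-- Bit index of the site `(x mod 3, y mod 3)`. [folklore] -/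
def idx (x y : ℕ) : ℕ := 3 * (x % 3) + y % 3

/-- Spin of configuration `c < 2⁹` at `(x, y)`. [folklore] -/
def spin (c : ℕ) (x y : ℕ) : ℤ := if Nat.testBit c (idx x y) then 1 else -1

/-- Gibbs weight `∏_{⟨ss'⟩} (2 + σ_s σ_{s'})` over the 18 nearest-neighbour bonds of the `3×3` torus. [folklore] -/
def weight (c : ℕ) : ℤ :=
  (((List.range 3).map fun x => ((List.range 3).map fun y =>
      (2 + spin c x y * spin c (x + 1) y) * (2 + spin c x y * spin c x (y + 1))).prod)).prod

/-- `F = 2σ(1,0) − σ(2,1) − σ(0,2)`, supported on the layer `u = x − y = 1`. [folklore] -/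
def F (c : ℕ) : ℤ := 2 * spin c 1 0 - spin c 2 1 - spin c 0 2

/-- `θF = F ∘ swap = 2σ(0,1) − σ(1,2) − σ(2,0)`, supported on `u = 2`. [folklore] -/
def Fθ (c : ℕ) : ℤ := 2 * spin c 0 1 - spin c 1 2 - spin c 2 0

/-- The swap pairing `∑_σ w(σ) F(σ) θF(σ)` (unnormalised). [folklore] -/
def pairing : ℤ := ((List.range 512).map fun c => weight c * F c * Fθ c).sum

/-- The exact value. [folklore] -/
theorem pairing_eq : pairing = -67184640 := by decide +kernel

/-- **The `3 × 3` Ising torus (equivalently ℤ₂ gauge theory on the `3×3×1` torus through its Polyakov spins) is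
not swap-reflection-positive.** [folklore] -/
theorem ising3_swap_pairing_neg : pairing < 0 := by rw [pairing_eq]; decide

end Ising3

/-! ## §5 Holes in the intended proof that are not counterexamples -/

section BetaSign

/-- **`β < 0`: the diagonal-cut plaquette weight is not cone-positive.** One-bond toy of a plaquette cut along
its diagonal (`U_p = s·t`, `s = P₊`, `t = θP₊ ∈ {±1}`): the swap pairing of `F = s` under the weight
`e^{β s t}` is `∑_{s,t} e^{βst} s t = 2e^{β} − 2e^{−β} < 0` for `β < 0`. (For `SU(2)` the spin-½ character
coefficient of `exp((β/2) tr g)` is `4 I₂(β)/β < 0` for `β < 0`.) The crux does not assume `β_k ≥ 0`; at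
strong negative coupling the limits are ultralocal anyway, so this is a hole in the intended proof (whose
lemma P1 needs `β ≥ 0`), not a counterexample; planners may add `∀ᶠ k, 0 ≤ sch.β k`. [folklore] -/
theorem twoSpin_pairing_neg_of_neg {β : ℝ} (hβ : β < 0) :
    ∑ s ∈ ({1, -1} : Finset ℤ), ∑ t ∈ ({1, -1} : Finset ℤ), Real.exp (β * s * t) * s * t < 0 := by
  have h1 : Real.exp β < Real.exp (-β) := Real.exp_lt_exp.2 (by linarith)
  simp [Finset.sum_pair (show (1 : ℤ) ≠ -1 by decide)]
  nlinarith [h1]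

end BetaSign


/-! ## §6 Load-bearing hypotheses (statements; see the findings index)

`hconv` is load-bearing: `¬ CruxWithoutLatticeConvergence` (cycle 1; re-derived in §8 of this file as
`Phantom.cruxWithoutLatticeConvergence_false`, standard axioms). Witness ("phantom
family"): `S₁ = vacuum + T₃`, `T₃(F) = ∑_{g ∈ W(B₄) × S₃} ∫_{ℝ⁸} F(g · Ψ z) dz` a tempered degree-3 distribution
supported on `𝒩 = {(x,y,w) ∈ (ℝ⁴)³ : every axis μ carries a coincidence xᵢ^μ = xⱼ^μ, i ≠ j}`. Structural fact
behind it: every e₀-based clause of `W₁` (hermiticity, E2, E4, `HasMassGap`) tests `S₁ n` only on test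
functions whose support has pairwise distinct TIMES; E3 + translations + proper signed permutations move that
class only inside `𝒟 = {some axis has all coordinates distinct}`; `𝒩 = 𝒟ᶜ` (non-empty from `n = 3` on,
symmetry-invariant) is a blind spot of the whole package minus `hconv`, while the diagonal frame
`R e₀ = (e₀+e₁)/√2` sees it (frame times `−1, 1, 3` are distinct although every axis carries a coincidence),
and the `(1,2)`-degree E2 block `conj(c)·α + c·β`, `Re α > 0`, is not positive. With `hconv` the Wilson data
pin `S₁` on `𝒩` too (off-diagonal real tensors are total there), so this is NOT a counterexample to the crux:
it says that ANY proof must use `hconv` in degrees `≥ 3`, on `𝒩`, where nothing else in `W₁` speaks. -/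

section LoadBearing

variable {G : Type} [Group G] [TopologicalSpace G] [IsTopologicalGroup G] [CompactSpace G]
  [MeasurableSpace G] [BorelSpace G]

/-- `W₁` with the lattice-convergence clause `hconv` deleted (everything else kept). [folklore] -/
def PackageWithoutConvergence (r : LatticeRep G) (sch : SpeciesScheme (YMSpecies G))
    (S₁ : SchwingerFamily E4) : Prop :=
  (S₁.toLabelled.IsNormalized ∧ S₁.toLabelled.IsHermitian ∧ S₁.toLabelled.HasLinearGrowth ∧
    S₁.toLabelled.IsReflectionPositive ∧ S₁.toLabelled.IsSymmetric ∧ S₁.toLabelled.HasClusterProperty) ∧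
  (∀ (n : ℕ) (a : E4) (F : 𝓢((Fin n → E4), ℂ)), IsOffDiagonal F → S₁ n (translateMulti a F) = S₁ n F) ∧
  (∀ (R : E4 ≃ₗᵢ[ℝ] E4), LinearMap.det (R.toLinearEquiv : E4 →ₗ[ℝ] E4) = 1 →
    (∀ i : Fin 4, ∃ j : Fin 4, R (EuclideanSpace.single i 1) = EuclideanSpace.single j 1 ∨
      R (EuclideanSpace.single i 1) = -EuclideanSpace.single j 1) →
    ∀ (n : ℕ) (F : 𝓢((Fin n → E4), ℂ)), IsOffDiagonal F → S₁ n (linActMulti R F) = S₁ n F) ∧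
  (∃ Δ : ℝ, 0 < Δ ∧ S₁.toLabelled.HasMassGap Δ ∧ HasLatticeMassGap r sch Δ)

omit [TopologicalSpace G] [IsTopologicalGroup G] [CompactSpace G] [BorelSpace G] in
/-- The package implies the package without convergence (bookkeeping). [folklore] -/
theorem CurvaturePackage.withoutConvergence [TopologicalSpace G] [IsTopologicalGroup G] [CompactSpace G]
    [BorelSpace G] {r : LatticeRep G} {sch : SpeciesScheme (YMSpecies G)} {S₁ : SchwingerFamily E4}
    (h : CurvaturePackage r sch S₁) : PackageWithoutConvergence r sch S₁ :=
  h.2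

end LoadBearing

/-- **The crux with `hconv` deleted** — FALSE (`Phantom.cruxWithoutLatticeConvergence_false`, §8). Provers:
your proof must separate this from the crux, i.e. use `hconv` in degrees `≥ 3` on `𝒩`. [folklore] -/
def CruxWithoutLatticeConvergence : Prop :=
  ∀ (G : Type) [Group G] [TopologicalSpace G] [IsTopologicalGroup G] [CompactSpace G],
    IsCompactSimpleLieGroup G →
      letI : MeasurableSpace G := borel G
      haveI : BorelSpace G := ⟨rfl⟩
      ∀ (r : LatticeRep G) (sch : SpeciesScheme (YMSpecies G)) (S₁ : SchwingerFamily E4),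
        PackageWithoutConvergence r sch S₁ → DiagonalFrameRP S₁

/-- Bookkeeping: the hconv-free statement implies the crux (so refuting the crux would refute it too, and a
proof of the crux that never uses `hconv` would prove the false statement). [folklore] -/
theorem crux_of_cruxWithoutLatticeConvergence (h : CruxWithoutLatticeConvergence) :
    Summit.QuantumFields.YangMills.Theses.PencilRigidity.DiagonalMirrorRPR := by
  rw [crux_iff]
  intro G _ _ _ _ hG r sch S₁ hW
  exact h G hG r sch S₁ hW.2

/-! ## §7 Cycle-2 notes for the intended proof (prose; no counterexample extracted)

* **TorusFreeInsensitivity cannot follow from the uniform gap alone.** Abstract lattice principle tested: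
  "translation-invariant finite-range model; connected time-correlations of symmetric local observables decay
  at a uniform rate on all periodic tori of side `≥ L_k` ⇒ local expectations on the torus of side `2L_k+1`
  and in the middle of the free box of the same size agree up to `o(1)`". FALSE near a first-order bulk
  transition: by the Borgs–Kotecký finite-size theory (J. Stat. Phys. 61 (1990)) the periodic torus follows
  the bulk phase diagram with rounding `O(L^{-d})`, while free boundary conditions shift the finite-volume
  transition by a surface term `O(L^{-1})` (Borgs–Kotecký–Medved', J. Stat. Phys. 109 (2002) 67–131, Thm 2.3,
  large-`q` Potts, Pirogov–Sinai; their Thm 2.1: free b.c. select the DISORDERED phase at `β_t`); in the window `L_k^{-d} ≪ β_k − β_t ≪ L_k^{-1}` the torus is ordered, the free box disordered,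
  and symmetric observables (energy density — the analogue of gauge-invariant ones; the `q` ordered phases are
  indistinguishable by them) cluster exponentially in both. 4D `SU(N)` Wilson theory has such bulk first-order
  transitions for large `N` (numerically; `β_k` is unconstrained in the crux). Both phases being RP, this does
  not break the CONCLUSION — it breaks the comparison "torus vs free box". Repair: compare the statement's odd
  tori with 45°-TILTED TORI `ℤ⁴/⟨(M,M,0,0),(N,−N,0,0),(0,0,P,0),(0,0,0,P)⟩` (boundaryless, exactly swap-RP for
  `β ≥ 0` by the cone argument, same bulk phase), i.e. a torus-vs-torus insensitivity at physical scale.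
* **What could still separate square odd tori from tilted tori** while a uniform gap holds on all square tori:
  geometry-sensitive (staggered / striped) phases — but frustration on odd tori forces delocalised defects,
  whose `O(1/S)` connected correlations at separation `∼ S` violate `C e^{−Δ a_k n}` for `n ≤ S`, `S` large;
  so such phases are excluded by `HasLatticeMassGap` as typed (it quantifies over ALL `S ≥ L_k`). No
  counterexample mechanism survives; the crux looks TRUE but its proof needs a genuinely new torus-vs-torus
  insensitivity theorem at physical scale (not in print beyond strong coupling).
* **Limit bookkeeping.** The conclusion tests `S₁ n` on `G = linActMulti R (θFᵢ* ⊗ Fⱼ)`, supported where the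
  `R e₀`-times are strictly ordered; `G` is a Schwartz limit of finite sums of off-diagonal REAL tensor
  products (spread the arguments apart along `R e₀` by `xᵢ ↦ xᵢ + i·T·R e₀`, `T → 0`, which is continuous in
  `𝓢`; cut off at infinity; apply the tree's box-Fourier lemma `mem_closure_span_boxTensors` with boxes whose
  `R e₀`-ranges are pairwise disjoint), so `hconv` + continuity pin every tested value. A junk `S₁` cannot
  refute the crux.

### Cycle-3 notes (regime sweep; literature)

* **Where a counterexample would have to live.** A scheme `(a_k, β_k, L_k, c_k, m_k)` refutes the crux only if
  its curvature correlators converge on `⁰𝒮` to a NON-ultralocal limit (ultralocal = constant on `⁰𝒮` =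
  diagonally RP, §3) while `HasLatticeMassGap` holds.  Bounded `β_k` (cluster-expansion regime) is ultralocal
  for every choice of `c_k, m_k`: a connected correlator `∼ c_k² e^{−m(β)δ/a_k}` at physical separation `δ`
  cannot have a finite non-zero limit for one `δ` without diverging for all smaller ones, and `hconv` quantifies
  over all off-diagonal tensors; at `β = 0` exactly the finite range of the Haar product makes every connected
  function vanish eventually, whatever `c_k`.  `β_k → +∞` faster than `log(1/a_k)` (near-Gaussian gluons; with
  `c_k = β_k a_k^{-4}` the two-point function would tend to the free `:F_μν F_μν:` function `∝ |x−y|^{-8}`) is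
  excluded by `HasLatticeMassGap`: at fixed `k` the lattice correlations then decay polynomially in `n` as
  `S → ∞`, not like `C e^{−Δ a_k n}`.  What remains are tuned critical regimes: the asymptotic-freedom trajectory
  itself (the Millennium problem) and endpoints of bulk first-order lines, which the crux DOES range over because
  `ρ` is any faithful unitary representation (reducible `ρ` = mixed fundamental–adjoint Bhanot–Creutz actions along
  a ray; `G = SO(3)` with its defining representation = adjoint `SU(2)` Wilson action, which has bulk transitions,
  Datta–Gavai, *Phase transitions in SO(3) lattice gauge theory*, arXiv:hep-lat/9708026) and `β_k → −∞`
  (§10; for `SU(2)` only a twist, for other `ρ` an antiferromagnetic-type model).  Staggered / anti-ferromagnetic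
  vacua breaking lattice symmetries are known numerically only for `SU(2)` actions with COMPETING plaquette
  interactions (Fingberg–Polonyi, *Anti-ferromagnetic condensate in Yang–Mills theory*, arXiv:hep-lat/9602003),
  i.e. outside the hard-coded single-plaquette Wilson action; and a symmetry-breaking limit would violate the
  `W(B₄)`-invariance + E4 clauses of `W₁` anyway (a pure stripe phase is not hypercubic, the symmetric mixture
  does not cluster).  None of these regimes is under rigorous control, and at each of them universality predicts
  an `O(4)`-invariant (hence diagonally RP) scaling limit.  Verdict unchanged: no kill; the crux is a genuine
  statement about controlled 4D Wilson continuum limits.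
* **Action-specificity (§9)** sharpens item 4 of the findings: not only must a proof use `hconv`, it must use the
  diagonal Schur structure of the plaquette action inside `hconv` — an RP, gapped, `W(B₄)`-symmetric finite-range
  lattice regularisation with an `a`-independent scaling limit can fail diagonal RP (the ℓ¹-Gaussian).
* Literature services (`lit search`, searchd) were unavailable during cycle 3 (rc 75); the two arXiv references
  above come from the galaxy PDF corpus (pages read: hep-lat/9602003 pp. 1–3); theorem numbers are deliberately not
  quoted from memory.
-/

/-- **Typed form of the limit-bookkeeping claim** (POSITIVE content, stated for provers; not proved here, no
`sorry`): for a direction `d` and an order pattern `σ`, every `n`-point test function supported where the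
`d`-times `⟪xᵢ, d⟫` are strictly increasing along `σ` is a Schwartz limit of finite `ℂ`-combinations of
OFF-DIAGONAL tensor products of real one-point test functions. (Sketch: spread the arguments apart by
`xᵢ ↦ xᵢ + c_{σ⁻¹ i}·T·d`, `c` increasing, `T → 0⁺`, continuous in `𝓢`; cut off at infinity inside the support;
apply the tree's `mem_closure_span_boxTensors` with boxes whose `d`-ranges are pairwise disjoint, so every box
tensor is off-diagonal.) With `hconv` and the continuity of each `S₁ n`, this pins every value the crux's
conclusion inspects (`d = R e₀`, `σ` = the E2 order pattern), which is why no junk `S₁` can refute the crux and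
why the crux is a statement about genuine Wilson limits. [folklore] -/
def OffDiagonalRealTensorsDenseInWedge : Prop :=
  ∀ (n : ℕ) (d : E4) (σ : Equiv.Perm (Fin n)) (G : 𝓢((Fin n → E4), ℂ)),
    tsupport (G : (Fin n → E4) → ℂ) ⊆ {x | StrictMono fun i => ⟪x (σ i), d⟫_ℝ} →
      G ∈ closure ((Submodule.span ℂ {F : 𝓢((Fin n → E4), ℂ) |
        ∃ f : Fin n → 𝓢(E4, ℝ), IsTensorOf F (fun i => ofRealTest (f i)) ∧ IsOffDiagonal F}) : Set 𝓢((Fin n → E4), ℂ))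

/-! ## §8 The phantom family: `hconv` is load-bearing (proof of `¬ CruxWithoutLatticeConvergence`)

Re-derivation (cycle 2) of the cycle-1 result, with a leaner witness: one carrier plane `V = Ψ(ℝ⁴ × ℝ⁴)`
(base point `a`, second point `a + v¹e₁`, third point `a + v⁰e₀ + v²e₂ + v³e₃`), averaged over the finite
subtype `SignedPerm` of `W(B₄)` (finiteness by the signature injection into `{±e_j}⁴`, invariance by
reindexing `g ↦ R.trans g`) and over `S₃`; translation invariance because `V` contains the diagonal.

### 8.1 Signed permutations of `ℝ⁴` -/

namespace Phantom

/-- The unit vector `e_i`. [folklore] -/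
abbrev e (i : Fin 4) : E4 := EuclideanSpace.single i 1

/-- Signed permutation isometries (the hyperoctahedral group `W(B₄)`, improper ones included), as the
subtype the crux's `W₁` quantifies over. [folklore] -/
def SignedPerm : Type := {g : E4 ≃ₗᵢ[ℝ] E4 // ∀ i : Fin 4, ∃ j : Fin 4, g (e i) = e j ∨ g (e i) = -e j}

namespace SignedPerm

/-- The identity. [folklore] -/
def one : SignedPerm := ⟨LinearIsometryEquiv.refl ℝ E4, fun i => ⟨i, Or.inl rfl⟩⟩

/-- Closure under composition (`R.trans g = g ∘ R`). [folklore] -/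
def comp (R g : SignedPerm) : SignedPerm :=
  ⟨R.1.trans g.1, fun i => by
    obtain ⟨j, hj⟩ := R.2 i
    obtain ⟨k, hk⟩ := g.2 j
    refine ⟨k, ?_⟩
    have h1 : (R.1.trans g.1) (e i) = g.1 (R.1 (e i)) := rfl
    rw [h1]
    rcases hj with hj | hj
    · rw [hj]; exact hk
    · rw [hj, map_neg]
      rcases hk with hk | hk
      · right; rw [hk]
      · left; rw [hk, neg_neg]⟩

/-- The finite set `{± e_j}`. [folklore] -/
def pm : Set E4 := Set.range fun p : Fin 4 × Bool => if p.2 then e p.1 else -e p.1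

instance : Finite pm := (Set.finite_range _).to_subtype

/-- The signature `i ↦ g eᵢ ∈ {± e_j}`. [folklore] -/
def sig (g : SignedPerm) : Fin 4 → pm := fun i =>
  ⟨g.1 (e i), by
    obtain ⟨j, hj⟩ := g.2 i
    rcases hj with hj | hj
    · exact ⟨(j, true), hj.symm⟩
    · exact ⟨(j, false), hj.symm⟩⟩

theorem sig_injective : Function.Injective sig := by
  intro g g' h
  have hb : ∀ i, g.1 (e i) = g'.1 (e i) := fun i => by
    have := congrFun h i
    rwa [Subtype.ext_iff] at this
  apply Subtype.ext
  apply LinearIsometryEquiv.toLinearEquiv_injective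
  apply LinearEquiv.toLinearMap_injective
  refine (EuclideanSpace.basisFun (Fin 4) ℝ).toBasis.ext fun i => ?_
  change g.1 ((EuclideanSpace.basisFun (Fin 4) ℝ).toBasis i) = g'.1 ((EuclideanSpace.basisFun (Fin 4) ℝ).toBasis i)
  rw [OrthonormalBasis.coe_toBasis, EuclideanSpace.basisFun_apply]
  exact hb i

instance : Finite SignedPerm := Finite.of_injective sig sig_injective

instance : Fintype SignedPerm := Fintype.ofFinite _

/-- Left composition by `R` is a bijection of `SignedPerm`. [folklore] -/
def compEquiv (R : SignedPerm) : SignedPerm ≃ SignedPerm :=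
  Equiv.ofBijective (comp R) (Finite.injective_iff_bijective.1 fun g g' h => by
    apply Subtype.ext
    have h1 : R.1.trans g.1 = R.1.trans g'.1 := congrArg Subtype.val h
    refine LinearIsometryEquiv.ext fun x => ?_
    have := congrArg (fun (T : E4 ≃ₗᵢ[ℝ] E4) => T (R.1.symm x)) h1
    simpa using this)

@[simp] theorem compEquiv_apply_val (R g : SignedPerm) : ((compEquiv R g).1 : E4 ≃ₗᵢ[ℝ] E4) = R.1.trans g.1 := rfl

/-- Time coordinate after a signed permutation: `(g⁻¹ v)⁰ = ± v_j` where `g e₀ = ± e_j`. [folklore] -/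
theorem symm_apply_zero (g : SignedPerm) :
    ∃ (j : Fin 4) (ε : ℝ), (ε = 1 ∨ ε = -1) ∧ ∀ v : E4, (g.1.symm v) 0 = ε * v j := by
  obtain ⟨j, hj⟩ := g.2 0
  have key : ∀ v : E4, (g.1.symm v) 0 = ⟪v, g.1 (e 0)⟫_ℝ := fun v => by
    have h1 : (g.1.symm v) 0 = ⟪g.1.symm v, e 0⟫_ℝ := by
      rw [EuclideanSpace.inner_single_right]; simp
    rw [h1, LinearIsometryEquiv.inner_map_eq_flip, LinearIsometryEquiv.symm_symm]
  rcases hj with hj | hj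
  · refine ⟨j, 1, Or.inl rfl, fun v => ?_⟩
    rw [key, hj, EuclideanSpace.inner_single_right]; simp
  · refine ⟨j, -1, Or.inr rfl, fun v => ?_⟩
    rw [key, hj, inner_neg_right, EuclideanSpace.inner_single_right]; simp

end SignedPerm

/-! ### 8.2 The carrier subspace `V ⊂ 𝒩` and the integration functional `I` -/

/-- Coordinate projection onto the axes in `S`: `(P_S v)^μ = v^μ` for `μ ∈ S`, else `0`. [folklore] -/
def proj (S : Finset (Fin 4)) : E4 →L[ℝ] E4 :=
  LinearMap.toContinuousLinearMap
    { toFun := fun v => WithLp.toLp 2 fun ν => if ν ∈ S then v ν else 0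
      map_add' := fun v w => by
        ext ν; by_cases h : ν ∈ S <;> simp [h]
      map_smul' := fun c v => by
        ext ν; by_cases h : ν ∈ S <;> simp [h] }

@[simp] theorem proj_apply (S : Finset (Fin 4)) (v : E4) (ν : Fin 4) :
    proj S v ν = if ν ∈ S then v ν else 0 := rfl

/-- Parameter space `ℝ⁴ × ℝ⁴` (as `Fin 2 → ℝ⁴`: base point `z 0`, relative data `z 1`). [folklore] -/
abbrev Z8 : Type := Fin 2 → E4

/-- The two coordinate projections of `Z8`. [folklore] -/
def pr (k : Fin 2) : Z8 →L[ℝ] E4 := ContinuousLinearMap.proj (R := ℝ) (φ := fun _ : Fin 2 => E4) k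

@[simp] theorem pr_apply (k : Fin 2) (z : Z8) : pr k z = z k := rfl

/-- `Ψ z = (a, a + P_{1} v, a + P_{0,2,3} v)` with `a = z 0`, `v = z 1`: the three points agree on axes
`0,2,3` (first two) and on axis `1` (first and third), so `Ψ z ∈ 𝒩` — every axis carries a coincidence —
while their diagonal times `x⁰ + x¹` are generically pairwise distinct. [folklore] -/
def Ψ : Z8 →L[ℝ] (Fin 3 → E4) :=
  ContinuousLinearMap.pi ![pr 0, pr 0 + (proj {1}).comp (pr 1), pr 0 + (proj {0, 2, 3}).comp (pr 1)]

theorem Ψ_apply_zero (z : Z8) : Ψ z 0 = z 0 := rfl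
theorem Ψ_apply_one (z : Z8) : Ψ z 1 = z 0 + proj {1} (z 1) := rfl
theorem Ψ_apply_two (z : Z8) : Ψ z 2 = z 0 + proj {0, 2, 3} (z 1) := rfl

/-- Every axis carries a coincidence on `Ψ z`. [folklore] -/
theorem Ψ_coincidence (z : Z8) (j : Fin 4) :
    ∃ i₁ i₂ : Fin 3, i₁ ≠ i₂ ∧ Ψ z i₁ j = Ψ z i₂ j := by
  by_cases hj : j = 1
  · subst hj
    refine ⟨0, 2, by decide, ?_⟩
    rw [Ψ_apply_zero, Ψ_apply_two, PiLp.add_apply, proj_apply]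
    simp
  · refine ⟨0, 1, by decide, ?_⟩
    rw [Ψ_apply_zero, Ψ_apply_one, PiLp.add_apply, proj_apply]
    simp [Finset.mem_singleton, hj]

/-- `Ψ` loses no information: `‖z‖ ≤ 4 (1 + ‖Ψ z‖)`. [folklore] -/
theorem norm_le_Ψ (z : Z8) : ‖z‖ ≤ 4 * (1 + ‖Ψ z‖) ^ 1 := by
  have h0 : ‖z 0‖ ≤ ‖Ψ z‖ := by
    have := norm_le_pi_norm (Ψ z) 0
    rwa [Ψ_apply_zero] at this
  have hv : z 1 = (Ψ z 1 - Ψ z 0) + (Ψ z 2 - Ψ z 0) := by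
    rw [Ψ_apply_zero, Ψ_apply_one, Ψ_apply_two, add_sub_cancel_left, add_sub_cancel_left]
    ext ν
    rw [PiLp.add_apply, proj_apply, proj_apply]
    fin_cases ν <;> simp
  have h1 : ‖z 1‖ ≤ 4 * ‖Ψ z‖ := by
    rw [hv]
    calc ‖(Ψ z 1 - Ψ z 0) + (Ψ z 2 - Ψ z 0)‖ ≤ ‖Ψ z 1 - Ψ z 0‖ + ‖Ψ z 2 - Ψ z 0‖ := norm_add_le _ _
      _ ≤ (‖Ψ z 1‖ + ‖Ψ z 0‖) + (‖Ψ z 2‖ + ‖Ψ z 0‖) := add_le_add (norm_sub_le _ _) (norm_sub_le _ _)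
      _ ≤ (‖Ψ z‖ + ‖Ψ z‖) + (‖Ψ z‖ + ‖Ψ z‖) := by
          gcongr <;> exact norm_le_pi_norm (Ψ z) _
      _ = 4 * ‖Ψ z‖ := by ring
  have hn : 0 ≤ ‖Ψ z‖ := norm_nonneg _
  rw [pow_one]
  refine (pi_norm_le_iff_of_nonneg (by positivity)).2 fun i => ?_
  fin_cases i
  · show ‖z 0‖ ≤ _ ; nlinarith
  · show ‖z 1‖ ≤ _ ; nlinarith

instance Z8_hasTemperateGrowth : (volume : Measure Z8).HasTemperateGrowth :=
  Measure.IsAddHaarMeasure.instHasTemperateGrowth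

/-- `I(F) = ∫_{ℝ⁴ × ℝ⁴} F(Ψ z) dz`: Lebesgue integration over the 8-dimensional subspace `V = Ψ(ℝ⁸) ⊂ 𝒩`. [folklore] -/
def I : 𝓢((Fin 3 → E4), ℂ) →L[ℂ] ℂ :=
  (SchwartzMap.integralCLM ℂ (volume : Measure Z8)).comp
    (SchwartzMap.compCLM ℂ (g := fun z : Z8 => Ψ z) Ψ.hasTemperateGrowth ⟨1, 4, norm_le_Ψ⟩)

theorem I_apply (F : 𝓢((Fin 3 → E4), ℂ)) : I F = ∫ z : Z8, F (Ψ z) := by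
  simp [I]

/-- The diagonal base point `(b, 0)`. [folklore] -/
def base (b : E4) : Z8 := ![b, 0]

theorem Ψ_base (b : E4) : Ψ (base b) = fun _ => b := by
  funext i
  fin_cases i
  · rfl
  · show Ψ (base b) 1 = b
    rw [Ψ_apply_one]; simp [base]
  · show Ψ (base b) 2 = b
    rw [Ψ_apply_two]; simp [base]

/-- `I` is translation invariant (the diagonal `(b,b,b) = Ψ(b,0)` lies in `V`). [folklore] -/
theorem I_translateMulti (b : E4) (F : 𝓢((Fin 3 → E4), ℂ)) : I (translateMulti b F) = I F := by
  rw [I_apply, I_apply]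
  have h : ∀ z : Z8, translateMulti b F (Ψ z) = (fun w : Z8 => F (Ψ w)) (z - base b) := by
    intro z
    rw [translateMulti_apply]
    show F _ = F _
    congr 1
    rw [map_sub, Ψ_base]
    rfl
  simp_rw [h]
  exact integral_sub_right_eq_self (fun w : Z8 => F (Ψ w)) (base b)

/-! ### 8.3 The averaged functional `T₃` and its invariances -/

/-- `T₃ = ∑_{g ∈ W(B₄)} ∑_{τ ∈ S₃} I ∘ permTest τ ∘ linActMulti g`. [folklore] -/
def T₃ : 𝓢((Fin 3 → E4), ℂ) →L[ℂ] ℂ :=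
  ∑ g : SignedPerm, ∑ τ : Equiv.Perm (Fin 3), I.comp ((permTest τ).comp (linActMulti g.1))

theorem T₃_apply (F : 𝓢((Fin 3 → E4), ℂ)) :
    T₃ F = ∑ g : SignedPerm, ∑ τ : Equiv.Perm (Fin 3), I (permTest τ (linActMulti g.1 F)) := by
  simp [T₃]

section Commute

variable {E : Type*} [NormedAddCommGroup E] [NormedSpace ℝ E] {n : ℕ}

theorem linActMulti_permTest (L : E ≃ₗᵢ[ℝ] E) (τ : Equiv.Perm (Fin n)) (F : 𝓢((Fin n → E), ℂ)) :
    linActMulti L (permTest τ F) = permTest τ (linActMulti L F) := by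
  ext x; simp [linActMulti_apply, permTest_apply, Function.comp_def]

theorem permTest_permTest (σ τ : Equiv.Perm (Fin n)) (F : 𝓢((Fin n → E), ℂ)) :
    permTest τ (permTest σ F) = permTest (τ * σ) F := by
  ext x; simp [permTest_apply, Function.comp_def]

theorem linActMulti_linActMulti (L M : E ≃ₗᵢ[ℝ] E) (F : 𝓢((Fin n → E), ℂ)) :
    linActMulti L (linActMulti M F) = linActMulti (M.trans L) F := by
  ext x; simp [linActMulti_apply]

theorem linActMulti_translateMulti (L : E ≃ₗᵢ[ℝ] E) (b : E) (F : 𝓢((Fin n → E), ℂ)) :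
    linActMulti L (translateMulti b F) = translateMulti (L b) (linActMulti L F) := by
  ext x; simp [linActMulti_apply, translateMulti_apply, map_sub]

theorem permTest_translateMulti (τ : Equiv.Perm (Fin n)) (b : E) (F : 𝓢((Fin n → E), ℂ)) :
    permTest τ (translateMulti b F) = translateMulti b (permTest τ F) := by
  ext x; simp [permTest_apply, translateMulti_apply, Function.comp_def]

theorem linActMulti_refl (F : 𝓢((Fin n → E), ℂ)) : linActMulti (LinearIsometryEquiv.refl ℝ E) F = F := by
  ext x; rfl

theorem permTest_one (F : 𝓢((Fin n → E), ℂ)) : permTest (1 : Equiv.Perm (Fin n)) F = F := by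
  ext x; simp [permTest_apply]

end Commute

/-- `T₃` is symmetric under `S₃`. [folklore] -/
theorem T₃_permTest (π : Equiv.Perm (Fin 3)) (F : 𝓢((Fin 3 → E4), ℂ)) : T₃ (permTest π F) = T₃ F := by
  rw [T₃_apply, T₃_apply]
  refine Finset.sum_congr rfl fun g _ => ?_
  simp_rw [linActMulti_permTest, permTest_permTest]
  exact Fintype.sum_equiv (Equiv.mulRight π) _ _ fun τ => rfl

/-- `T₃` is invariant under every signed permutation (proper or not). [folklore] -/
theorem T₃_linActMulti (R : SignedPerm) (F : 𝓢((Fin 3 → E4), ℂ)) : T₃ (linActMulti R.1 F) = T₃ F := by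
  rw [T₃_apply, T₃_apply]
  simp_rw [linActMulti_linActMulti]
  exact Fintype.sum_equiv (SignedPerm.compEquiv R) _ _ fun g => rfl

/-- `T₃` is translation invariant. [folklore] -/
theorem T₃_translateMulti (b : E4) (F : 𝓢((Fin 3 → E4), ℂ)) : T₃ (translateMulti b F) = T₃ F := by
  rw [T₃_apply, T₃_apply]
  refine Finset.sum_congr rfl fun g _ => Finset.sum_congr rfl fun τ _ => ?_
  rw [linActMulti_translateMulti, permTest_translateMulti, I_translateMulti]

/-! ### 8.4 The blind spot: `T₃` vanishes on time-separated test functions -/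

/-- `F` is time-separated: wherever `F ≠ 0` the time coordinates are pairwise distinct. [folklore] -/
def TimeSep {n : ℕ} (F : 𝓢((Fin n → E4), ℂ)) : Prop :=
  ∀ x, F x ≠ 0 → Function.Injective fun i => x i 0

/-- **Blind spot.** `T₃ F = 0` for every time-separated `F`: all points fed to `F` lie in `𝒩`, whose
configurations have a coincidence on the axis that the signed permutation turns into time. [folklore] -/
theorem T₃_eq_zero_of_timeSep {F : 𝓢((Fin 3 → E4), ℂ)} (hF : TimeSep F) : T₃ F = 0 := by
  rw [T₃_apply]
  refine Finset.sum_eq_zero fun g _ => Finset.sum_eq_zero fun τ _ => ?_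
  rw [I_apply]
  refine integral_eq_zero_of_ae (Eventually.of_forall fun z => ?_)
  simp only [permTest_apply, linActMulti_apply, Pi.zero_apply]
  by_contra hne
  have hinj := hF _ hne
  obtain ⟨j, ε, -, hj⟩ := SignedPerm.symm_apply_zero g
  obtain ⟨i₁, i₂, hne12, hcoin⟩ := Ψ_coincidence z j
  have h := @hinj (τ.symm i₁) (τ.symm i₂) (by
    simp only [Function.comp_apply, Equiv.apply_symm_apply, hj, hcoin])
  exact hne12 (τ.symm.injective h)


/-! ### 8.5 The phantom family `𝔖 = vacuum + T₃` and its package -/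

/-- The degree-3 phantom as a Schwinger family (zero in all other degrees). [folklore] -/
def phantom : SchwingerFamily E4
  | 3 => T₃
  | _ => 0

@[simp] theorem phantom_three : phantom 3 = T₃ := rfl

theorem phantom_of_ne_three {n : ℕ} (hn : n ≠ 3) : phantom n = 0 := by
  match n, hn with
  | 0, _ => rfl
  | 1, _ => rfl
  | 2, _ => rfl
  | 3, h => exact absurd rfl h
  | _ + 4, _ => rfl

/-- **The phantom family**: vacuum plus the degree-3 phantom. [folklore] -/
def phantomFamily : SchwingerFamily E4 := fun n => vacuumFamily n + phantom n

theorem phantomFamily_apply {n : ℕ} (F : 𝓢((Fin n → E4), ℂ)) :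
    phantomFamily n F = vacuumFamily n F + phantom n F := rfl

theorem vacuumFamily_apply {n : ℕ} (F : 𝓢((Fin n → E4), ℂ)) :
    vacuumFamily n F = if n = 0 then F 0 else 0 :=
  LabelledSchwingerFamily.trivial_apply _ _ _ _

/-- The phantom vanishes on time-separated test functions, in every degree. [folklore] -/
theorem phantom_apply_eq_zero_of_timeSep {n : ℕ} {F : 𝓢((Fin n → E4), ℂ)} (hF : TimeSep F) :
    phantom n F = 0 := by
  by_cases hn : n = 3
  · subst hn
    exact T₃_eq_zero_of_timeSep hF
  · rw [phantom_of_ne_three hn]; rfl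

theorem phantomFamily_apply_of_timeSep {n : ℕ} {F : 𝓢((Fin n → E4), ℂ)} (hF : TimeSep F) :
    phantomFamily n F = LabelledSchwingerFamily.trivial Unit E4 n (fun _ => ()) F := by
  rw [phantomFamily_apply, phantom_apply_eq_zero_of_timeSep hF, add_zero]; rfl

/-! #### Time-separation bookkeeping -/

section TimeSepLemmas

variable {n m : ℕ}

/-- All times negative wherever `F ≠ 0`. [folklore] -/
def NegTime (F : 𝓢((Fin n → E4), ℂ)) : Prop := ∀ x, F x ≠ 0 → ∀ i, x i 0 < 0

/-- All times positive wherever `F ≠ 0`. [folklore] -/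
def PosTime (F : 𝓢((Fin n → E4), ℂ)) : Prop := ∀ x, F x ≠ 0 → ∀ i, 0 < x i 0

theorem mem_tsupport_of_ne {F : 𝓢((Fin n → E4), ℂ)} {x : Fin n → E4} (hx : F x ≠ 0) :
    x ∈ tsupport (F : (Fin n → E4) → ℂ) :=
  subset_tsupport _ (Function.mem_support.2 hx)

theorem IsTimeOrdered.timeSep {F : 𝓢((Fin n → E4), ℂ)} (hF : IsTimeOrdered F) : TimeSep F :=
  fun _ hx => (hF (mem_tsupport_of_ne hx)).2.injective

theorem IsTimeOrdered.posTime {F : 𝓢((Fin n → E4), ℂ)} (hF : IsTimeOrdered F) : PosTime F :=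
  fun _ hx => (hF (mem_tsupport_of_ne hx)).1

theorem osAdjoint_ne_zero {F : 𝓢((Fin n → E4), ℂ)} {x : Fin n → E4} (hx : osAdjoint F x ≠ 0) :
    F (fun i => timeReflection 4 (x (Fin.rev i))) ≠ 0 := by
  rw [osAdjoint_apply] at hx
  exact fun h => hx (by rw [h, map_zero])

theorem TimeSep.osAdjoint {F : 𝓢((Fin n → E4), ℂ)} (hF : TimeSep F) : TimeSep (osAdjoint F) := by
  intro x hx a b hab
  have hinj := hF _ (osAdjoint_ne_zero hx)
  have h : (fun i => (timeReflection 4 (x (Fin.rev i))) 0) (Fin.rev a) =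
      (fun i => (timeReflection 4 (x (Fin.rev i))) 0) (Fin.rev b) := by
    simp only [timeReflection_apply, Fin.rev_rev, ↓reduceIte]
    exact congrArg Neg.neg hab
  simpa using hinj h

theorem PosTime.negTime_osAdjoint {F : 𝓢((Fin n → E4), ℂ)} (hF : PosTime F) : NegTime (osAdjoint F) := by
  intro x hx i
  have h := hF _ (osAdjoint_ne_zero hx) (Fin.rev i)
  simp only [timeReflection_apply, Fin.rev_rev, ↓reduceIte] at h
  linarith

theorem TimeSep.translateMulti {F : 𝓢((Fin n → E4), ℂ)} (hF : TimeSep F) (a : E4) :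
    TimeSep (translateMulti a F) := by
  intro x hx i j hij
  rw [translateMulti_apply] at hx
  refine hF _ hx ?_
  dsimp only at hij ⊢
  simp only [PiLp.sub_apply, hij]

theorem PosTime.translateMulti_spatial {F : 𝓢((Fin n → E4), ℂ)} (hF : PosTime F) {a : E4} (ha : a 0 = 0)
    (t : ℝ) : PosTime (translateMulti (t • a) F) := by
  intro x hx i
  rw [translateMulti_apply] at hx
  have h := hF _ hx i
  simp only [PiLp.sub_apply, PiLp.smul_apply, ha, smul_eq_mul, mul_zero, sub_zero] at h
  exact h

theorem PosTime.translateMulti_time {F : 𝓢((Fin n → E4), ℂ)} (hF : PosTime F) {t : ℝ} (ht : 0 ≤ t) :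
    PosTime (translateMulti (EuclideanSpace.single 0 t) F) := by
  intro x hx i
  rw [translateMulti_apply] at hx
  have h := hF _ hx i
  simp only [PiLp.sub_apply, PiLp.single_apply, ↓reduceIte] at h
  linarith

/-- Appending a negative-time block to a positive-time block keeps the times separated. [folklore] -/
theorem TimeSep.append {H : 𝓢((Fin (n + m) → E4), ℂ)} {A : 𝓢((Fin n → E4), ℂ)} {B : 𝓢((Fin m → E4), ℂ)}
    (hH : IsAppendTensorOf H A B) (hA : TimeSep A) (hA' : NegTime A) (hB : TimeSep B) (hB' : PosTime B) :
    TimeSep H := by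
  intro x hx
  rw [hH x] at hx
  have hA0 : A (x ∘ Fin.castAdd m) ≠ 0 := left_ne_zero_of_mul hx
  have hB0 : B (x ∘ Fin.natAdd n) ≠ 0 := right_ne_zero_of_mul hx
  intro a b hab
  induction a using Fin.addCases with
  | left a =>
    induction b using Fin.addCases with
    | left b => exact congrArg _ (hA _ hA0 (a₁ := a) (a₂ := b) hab)
    | right b =>
      exfalso
      have h1 := hA' _ hA0 a
      have h2 := hB' _ hB0 b
      simp only [Function.comp_apply] at h1 h2
      change x (Fin.castAdd m a) 0 = x (Fin.natAdd n b) 0 at hab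
      linarith
  | right a =>
    induction b using Fin.addCases with
    | left b =>
      exfalso
      have h1 := hB' _ hB0 a
      have h2 := hA' _ hA0 b
      simp only [Function.comp_apply] at h1 h2
      change x (Fin.natAdd n a) 0 = x (Fin.castAdd m b) 0 at hab
      linarith
    | right b => exact congrArg _ (hB _ hB0 (a₁ := a) (a₂ := b) hab)

/-- The E2 / E4 / mass-gap test functions `θF* ⊗ G` are time-separated. [folklore] -/
theorem timeSep_of_appendTensor {H : 𝓢((Fin (n + m) → E4), ℂ)} {F : 𝓢((Fin n → E4), ℂ)}
    {G : 𝓢((Fin m → E4), ℂ)} (hF : IsTimeOrdered F) (hG : TimeSep G) (hG' : PosTime G)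
    (hH : IsAppendTensorOf H (osAdjoint F) G) : TimeSep H :=
  TimeSep.append hH (IsTimeOrdered.timeSep hF).osAdjoint (IsTimeOrdered.posTime hF).negTime_osAdjoint hG hG'

end TimeSepLemmas

/-! #### The package `W₁ ∖ hconv` holds for the phantom family -/

theorem phantomFamily_isNormalized : phantomFamily.toLabelled.IsNormalized := by
  intro k F
  rw [SchwingerFamily.toLabelled_apply, phantomFamily_apply, vacuumFamily_apply, if_pos rfl,
    phantom_of_ne_three (by decide)]
  simp only [zero_apply, add_zero]
  exact congrArg F (Subsingleton.elim _ _)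

theorem phantomFamily_isHermitian : phantomFamily.toLabelled.IsHermitian := by
  intro n k F hF
  rw [SchwingerFamily.toLabelled_apply, SchwingerFamily.toLabelled_apply,
    phantomFamily_apply_of_timeSep (IsTimeOrdered.timeSep hF),
    phantomFamily_apply_of_timeSep (IsTimeOrdered.timeSep hF).osAdjoint]
  exact (OSAxiomsSchwinger.trivial (ι := Unit) (d := 4)).hermitian n k F hF

theorem phantomFamily_hasLinearGrowth : phantomFamily.toLabelled.HasLinearGrowth := by
  intro T
  obtain ⟨s₃, C₃, h₃⟩ := SchwingerFamily.exists_bound_holds phantomFamily 3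
  refine ⟨s₃ + 1, max C₃ 0 + 1, 0, fun n k _ F _ => ?_⟩
  rw [Real.rpow_zero, mul_one, SchwingerFamily.toLabelled_apply]
  have hsn : 0 ≤ schwartzNorm (n * (s₃ + 1)) F := schwartzNorm_nonneg _ _
  by_cases hn3 : n = 3
  · subst hn3
    have hα : 0 ≤ max C₃ 0 + 1 := by have := le_max_right C₃ 0; linarith
    calc ‖phantomFamily 3 F‖ ≤ C₃ * schwartzNorm s₃ F := h₃ F
      _ ≤ (max C₃ 0 + 1) * schwartzNorm s₃ F :=
          mul_le_mul_of_nonneg_right (by linarith [le_max_left C₃ 0]) (schwartzNorm_nonneg _ _)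
      _ ≤ (max C₃ 0 + 1) * schwartzNorm (3 * (s₃ + 1)) F :=
          mul_le_mul_of_nonneg_left (schwartzNorm_mono (by omega) F) hα
  · rw [phantomFamily_apply, phantom_of_ne_three hn3, vacuumFamily_apply]
    split_ifs with hn0
    · subst hn0
      simp only [zero_apply, add_zero]
      calc ‖F 0‖ ≤ schwartzNorm (0 * (s₃ + 1)) F := norm_le_schwartzNorm _ F 0
        _ ≤ (max C₃ 0 + 1) * schwartzNorm (0 * (s₃ + 1)) F :=
            le_mul_of_one_le_left (schwartzNorm_nonneg _ _) (by linarith [le_max_right C₃ 0])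
    · simp only [zero_apply, add_zero, norm_zero]
      exact mul_nonneg (by have := le_max_right C₃ 0; linarith) hsn

theorem phantomFamily_isReflectionPositive : phantomFamily.toLabelled.IsReflectionPositive := by
  intro N deg lab F hF H hH
  have hterm : ∀ i j, phantomFamily.toLabelled (deg i + deg j) (Fin.append (lab i ∘ Fin.rev) (lab j)) (H i j) =
      LabelledSchwingerFamily.trivial Unit E4 (deg i + deg j) (Fin.append (lab i ∘ Fin.rev) (lab j)) (H i j) := by
    intro i j
    rw [SchwingerFamily.toLabelled_apply, phantomFamily_apply_of_timeSep
      (timeSep_of_appendTensor (hF i) (IsTimeOrdered.timeSep (hF j)) (IsTimeOrdered.posTime (hF j)) (hH i j))]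
  simp only [hterm]
  exact (OSAxiomsSchwinger.trivial (ι := Unit) (d := 4)).reflectionPositive N deg lab F hF H hH

theorem phantomFamily_isSymmetric : phantomFamily.toLabelled.IsSymmetric := by
  intro n k π F _
  rw [SchwingerFamily.toLabelled_apply, SchwingerFamily.toLabelled_apply, phantomFamily_apply,
    phantomFamily_apply, vacuumFamily_apply, vacuumFamily_apply]
  congr 1
  · split_ifs with hn
    · subst hn; rw [permTest_apply]; exact congrArg F (Subsingleton.elim _ _)
    · rfl
  · by_cases hn : n = 3
    · subst hn; exact T₃_permTest π F
    · rw [phantom_of_ne_three hn]; rfl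

theorem phantomFamily_hasClusterProperty : phantomFamily.toLabelled.HasClusterProperty := by
  intro n m k k' F G hF hG a ha0 ha H hH
  have h1 : ∀ t, phantomFamily.toLabelled (n + m) (Fin.append (k ∘ Fin.rev) k') (H t) =
      LabelledSchwingerFamily.trivial Unit E4 (n + m) (Fin.append (k ∘ Fin.rev) k') (H t) := fun t => by
    rw [SchwingerFamily.toLabelled_apply, phantomFamily_apply_of_timeSep
      (timeSep_of_appendTensor hF ((IsTimeOrdered.timeSep hG).translateMulti _)
        ((IsTimeOrdered.posTime hG).translateMulti_spatial ha0 t) (hH t))]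
  have h2 : phantomFamily.toLabelled n (k ∘ Fin.rev) (osAdjoint F) =
      LabelledSchwingerFamily.trivial Unit E4 n (k ∘ Fin.rev) (osAdjoint F) := by
    rw [SchwingerFamily.toLabelled_apply, phantomFamily_apply_of_timeSep (IsTimeOrdered.timeSep hF).osAdjoint]
  have h3 : phantomFamily.toLabelled m k' G = LabelledSchwingerFamily.trivial Unit E4 m k' G := by
    rw [SchwingerFamily.toLabelled_apply, phantomFamily_apply_of_timeSep (IsTimeOrdered.timeSep hG)]
  simp only [h1, h2, h3]
  exact (OSAxiomsSchwinger.trivial (ι := Unit) (d := 4)).cluster n m k k' F G hF hG a ha0 ha H hH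

theorem phantomFamily_translateMulti (n : ℕ) (a : E4) (F : 𝓢((Fin n → E4), ℂ)) :
    phantomFamily n (translateMulti a F) = phantomFamily n F := by
  rw [phantomFamily_apply, phantomFamily_apply, vacuumFamily_apply, vacuumFamily_apply]
  congr 1
  · split_ifs with hn
    · subst hn; rw [translateMulti_apply]; exact congrArg F (Subsingleton.elim _ _)
    · rfl
  · by_cases hn : n = 3
    · subst hn; exact T₃_translateMulti a F
    · rw [phantom_of_ne_three hn]; rfl

theorem phantomFamily_linActMulti (R : SignedPerm) (n : ℕ) (F : 𝓢((Fin n → E4), ℂ)) :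
    phantomFamily n (linActMulti R.1 F) = phantomFamily n F := by
  rw [phantomFamily_apply, phantomFamily_apply, vacuumFamily_apply, vacuumFamily_apply]
  congr 1
  · split_ifs with hn
    · subst hn; rw [linActMulti_apply]; exact congrArg F (Subsingleton.elim _ _)
    · rfl
  · by_cases hn : n = 3
    · subst hn; exact T₃_linActMulti R F
    · rw [phantom_of_ne_three hn]; rfl

theorem phantomFamily_hasMassGap (Δ : ℝ) : phantomFamily.toLabelled.HasMassGap Δ := by
  intro n m k k' F G hF hG
  obtain ⟨C, hC⟩ := OSData.vacuum_hasMassGap (ι := Unit) (d := 4) Δ n m k k' F G hF hG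
  refine ⟨C, fun t ht H hH => ?_⟩
  have h1 : phantomFamily.toLabelled (n + m) (Fin.append (k ∘ Fin.rev) k') H =
      LabelledSchwingerFamily.trivial Unit E4 (n + m) (Fin.append (k ∘ Fin.rev) k') H := by
    rw [SchwingerFamily.toLabelled_apply, phantomFamily_apply_of_timeSep
      (timeSep_of_appendTensor hF ((IsTimeOrdered.timeSep hG).translateMulti _)
        ((IsTimeOrdered.posTime hG).translateMulti_time ht) hH)]
  have h2 : phantomFamily.toLabelled n (k ∘ Fin.rev) (osAdjoint F) =
      LabelledSchwingerFamily.trivial Unit E4 n (k ∘ Fin.rev) (osAdjoint F) := by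
    rw [SchwingerFamily.toLabelled_apply, phantomFamily_apply_of_timeSep (IsTimeOrdered.timeSep hF).osAdjoint]
  have h3 : phantomFamily.toLabelled m k' G = LabelledSchwingerFamily.trivial Unit E4 m k' G := by
    rw [SchwingerFamily.toLabelled_apply, phantomFamily_apply_of_timeSep (IsTimeOrdered.timeSep hG)]
  rw [h1, h2, h3]
  exact hC t ht H hH

/-- **The phantom family carries the whole package `W₁` minus `hconv`** over the zero scheme (any `G`, `r`). [folklore] -/
theorem packageWithoutConvergence_phantomFamily {G : Type} [Group G] [TopologicalSpace G]
    [IsTopologicalGroup G] [CompactSpace G] [MeasurableSpace G] [BorelSpace G] (r : LatticeRep G) :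
    PackageWithoutConvergence r (SpeciesScheme.zero _) phantomFamily := by
  refine ⟨⟨phantomFamily_isNormalized, phantomFamily_isHermitian, phantomFamily_hasLinearGrowth,
    phantomFamily_isReflectionPositive, phantomFamily_isSymmetric, phantomFamily_hasClusterProperty⟩,
    fun n a F _ => phantomFamily_translateMulti n a F, fun R _ hR n F _ => ?_,
    ⟨1, one_pos, phantomFamily_hasMassGap 1, hasLatticeMassGap_of_beta_eq_zero r _ (fun _ => rfl) 1⟩⟩
  exact phantomFamily_linActMulti ⟨R, hR⟩ n F


/-! ### 8.6 The diagonal frame sees the phantom: `¬ DiagonalFrameRP phantomFamily` -/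

section Witness

/-- A diagonal frame: the reflection taking `e₀` to `(e₀ + e₁)/√2`. [folklore] -/
theorem exists_frame : ∃ (R : E4 ≃ₗᵢ[ℝ] E4) (a : ℝ), a ^ 2 = 1 / 2 ∧ 0 < a ∧
    R (e 0) = a • e 0 + a • e 1 := by
  set a : ℝ := 1 / Real.sqrt 2 with ha_def
  have ha0 : 0 < a := by positivity
  have ha2 : a ^ 2 = 1 / 2 := by
    rw [ha_def, div_pow, one_pow, Real.sq_sqrt (by norm_num : (0 : ℝ) ≤ 2)]
  set v : E4 := e 0 with hv
  set w : E4 := a • e 0 + a • e 1 with hw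
  have hnorm : ‖v‖ = ‖w‖ := by
    have h1 : ‖v‖ = 1 := by rw [hv, EuclideanSpace.norm_eq]; simp [e]
    have h2 : ‖w‖ = 1 := by
      have hsum : ∑ i : Fin 4, ‖w i‖ ^ 2 = a ^ 2 + a ^ 2 := by
        rw [hw]; simp [Fin.sum_univ_four, e, PiLp.single_apply]
      rw [EuclideanSpace.norm_eq, hsum, ← two_mul, ha2]; norm_num
    rw [h1, h2]
  exact ⟨(Submodule.span ℝ {v - w})ᗮ.reflection, a, ha2, ha0, Submodule.reflection_sub hnorm⟩

variable {R : E4 ≃ₗᵢ[ℝ] E4} {a : ℝ}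

/-- Frame time: `(R⁻¹ p)⁰ = ⟨p, R e₀⟩ = a (p⁰ + p¹)`. [folklore] -/
theorem frame_time (hR : R (e 0) = a • e 0 + a • e 1) (p : E4) : (R.symm p) 0 = a * (p 0 + p 1) := by
  have h1 : (R.symm p) 0 = ⟪R.symm p, e 0⟫_ℝ := by rw [EuclideanSpace.inner_single_right]; simp
  rw [h1, LinearIsometryEquiv.inner_map_eq_flip, LinearIsometryEquiv.symm_symm, hR, inner_add_right,
    inner_smul_right, inner_smul_right, EuclideanSpace.inner_single_right, EuclideanSpace.inner_single_right]
  simp; ring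

/-- The target configuration: `x₀ = (−1,−1,0,0)`, `v₀ = (8,4,0,0)`, `z₀ = (x₀, v₀)`,
`Ψ z₀ = (x₀, y₀, w₀)` with `y₀ = (−1,3,0,0)`, `w₀ = (7,−1,0,0)`; frame times `−2a, 2a, 6a`. [folklore] -/
def x₀ : E4 := -e 0 - e 1
def v₀ : E4 := (8 : ℝ) • e 0 + (4 : ℝ) • e 1
def z₀ : Z8 := ![x₀, v₀]
def y₀ : E4 := x₀ + proj {1} v₀
def w₀ : E4 := x₀ + proj {0, 2, 3} v₀

theorem Ψ_z₀ : Ψ z₀ = ![x₀, y₀, w₀] := by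
  funext i; fin_cases i <;> rfl

@[simp] theorem x₀_zero : x₀ 0 = -1 := by simp [x₀, e]
@[simp] theorem x₀_one : x₀ 1 = -1 := by simp [x₀, e]
@[simp] theorem y₀_zero : y₀ 0 = -1 := by simp [y₀, v₀, e]
@[simp] theorem y₀_one : y₀ 1 = 3 := by simp [y₀, v₀, e]; norm_num
@[simp] theorem w₀_zero : w₀ 0 = 7 := by simp [w₀, v₀, e]; norm_num
@[simp] theorem w₀_one : w₀ 1 = -1 := by simp [w₀, v₀, e]

variable (R) (ha : 0 < a)

/-- The bump of radius `a` (plateau `a/2`) at `c`. [folklore] -/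
def bump (c : E4) : ContDiffBump c := ⟨a / 2, a, by positivity, by linarith⟩

theorem bump_apply_self (c : E4) : (bump ha c) c = 1 :=
  (bump ha c).one_of_mem_closedBall (Metric.mem_closedBall_self (bump ha c).rIn_pos.le)

theorem bump_eq_zero {c x : E4} (hx : x ∉ Metric.closedBall c a) : (bump ha c) x = 0 := by
  apply (bump ha c).zero_of_le_dist
  change a ≤ dist x c
  rw [Metric.mem_closedBall, not_le] at hx
  exact hx.le

theorem time_ge_of_mem_closedBall {c x : E4} (hx : x ∈ Metric.closedBall c a) : c 0 - a ≤ x 0 ∧ x 0 ≤ c 0 + a := by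
  rw [Metric.mem_closedBall, dist_eq_norm] at hx
  have h : |(x - c) 0| ≤ a := le_trans (by simpa using PiLp.norm_apply_le (x - c) 0) hx
  rw [PiLp.sub_apply, abs_le] at h
  constructor <;> linarith [h.1, h.2]

/-- One-point test function: the bump at `c`, as a complex Schwartz function on `(ℝ⁴)¹`. [folklore] -/
def F₁ (c : E4) : 𝓢((Fin 1 → E4), ℂ) :=
  HasCompactSupport.toSchwartzMap (f := fun p : Fin 1 → E4 => ((bump ha c) (p 0) : ℂ))
    (HasCompactSupport.intro (isCompact_univ_pi fun _ : Fin 1 => isCompact_closedBall c a) fun p hp => by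
      simp only [Set.mem_univ_pi, not_forall] at hp
      obtain ⟨i, hi⟩ := hp
      have hi0 : i = 0 := Subsingleton.elim _ _
      subst hi0
      simp [bump_eq_zero ha hi])
    (Complex.ofRealCLM.contDiff.comp ((bump ha c).contDiff.comp (contDiff_apply ℝ E4 (0 : Fin 1))))

@[simp] theorem F₁_apply (c : E4) (p : Fin 1 → E4) : F₁ ha c p = ((bump ha c) (p 0) : ℂ) := rfl

/-- Two-point test function: bumps at `c` and `c'`. [folklore] -/
def F₂ (c c' : E4) : 𝓢((Fin 2 → E4), ℂ) :=
  HasCompactSupport.toSchwartzMap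
    (f := fun p : Fin 2 → E4 => (((bump ha c) (p 0) * (bump ha c') (p 1) : ℝ) : ℂ))
    (HasCompactSupport.intro (isCompact_univ_pi fun i : Fin 2 => isCompact_closedBall (![c, c'] i) a)
      fun p hp => by
        simp only [Set.mem_univ_pi, not_forall] at hp
        obtain ⟨i, hi⟩ := hp
        fin_cases i
        · simp [bump_eq_zero ha (c := c) (by simpa using hi)]
        · simp [bump_eq_zero ha (c := c') (by simpa using hi)])
    (Complex.ofRealCLM.contDiff.comp
      (((bump ha c).contDiff.comp (contDiff_apply ℝ E4 (0 : Fin 2))).mul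
        ((bump ha c').contDiff.comp (contDiff_apply ℝ E4 (1 : Fin 2)))))

@[simp] theorem F₂_apply (c c' : E4) (p : Fin 2 → E4) :
    F₂ ha c c' p = (((bump ha c) (p 0) * (bump ha c') (p 1) : ℝ) : ℂ) := rfl

theorem isTimeOrdered_F₁ {c : E4} (hc : a < c 0) : IsTimeOrdered (F₁ ha c) := by
  have hK : tsupport (F₁ ha c : (Fin 1 → E4) → ℂ) ⊆ {p | p 0 ∈ Metric.closedBall c a} := by
    refine closure_minimal (fun p hp => ?_) (Metric.isClosed_closedBall.preimage (continuous_apply 0))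
    by_contra h
    exact hp (by simp [bump_eq_zero ha h])
  intro p hp
  have h0 := (time_ge_of_mem_closedBall (hK hp)).1
  refine ⟨fun i => ?_, fun i j hij => ?_⟩
  · rw [Subsingleton.elim i 0]; linarith
  · exact absurd hij (by rw [Subsingleton.elim i j]; exact lt_irrefl _)

theorem isTimeOrdered_F₂ {c c' : E4} (hc : a < c 0) (hcc' : c 0 + a < c' 0 - a) : IsTimeOrdered (F₂ ha c c') := by
  have hK : tsupport (F₂ ha c c' : (Fin 2 → E4) → ℂ) ⊆
      {p | p 0 ∈ Metric.closedBall c a ∧ p 1 ∈ Metric.closedBall c' a} := by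
    refine closure_minimal (fun p hp => ?_) ?_
    · constructor
      · by_contra h; exact hp (by simp [bump_eq_zero ha h])
      · by_contra h; exact hp (by simp [bump_eq_zero ha h])
    · have h0c : IsClosed {p : Fin 2 → E4 | p 0 ∈ Metric.closedBall c a} :=
        Metric.isClosed_closedBall.preimage (continuous_apply 0)
      have h1c : IsClosed {p : Fin 2 → E4 | p 1 ∈ Metric.closedBall c' a} :=
        Metric.isClosed_closedBall.preimage (continuous_apply 1)
      exact h0c.inter h1c
  intro p hp
  obtain ⟨h0, h1⟩ := hK hp
  have t0 := time_ge_of_mem_closedBall h0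
  have t1 := time_ge_of_mem_closedBall h1
  refine ⟨fun i => ?_, fun i j hij => ?_⟩
  · fin_cases i
    · show 0 < p 0 0; linarith [t0.1]
    · show 0 < p 1 0; linarith [t1.1]
  · fin_cases i <;> fin_cases j
    · exact absurd hij (lt_irrefl _)
    · show p 0 0 < p 1 0; linarith [t0.2, t1.1]
    · exact absurd hij (by decide)
    · exact absurd hij (lt_irrefl _)

/-- The centres: `c_A = θ R⁻¹ x₀` (time `2a`), `c₀ = R⁻¹ y₀` (time `2a`), `c₁ = R⁻¹ w₀` (time `6a`). [folklore] -/
def cA : E4 := timeReflection 4 (R.symm x₀)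
def c₀ : E4 := R.symm y₀
def c₁ : E4 := R.symm w₀

variable {R}

theorem cA_zero (hR : R (e 0) = a • e 0 + a • e 1) : cA R 0 = 2 * a := by
  rw [cA, timeReflection_apply, if_pos rfl, frame_time hR]; simp; ring
theorem c₀_zero (hR : R (e 0) = a • e 0 + a • e 1) : c₀ R 0 = 2 * a := by
  rw [c₀, frame_time hR]; simp; ring
theorem c₁_zero (hR : R (e 0) = a • e 0 + a • e 1) : c₁ R 0 = 6 * a := by
  rw [c₁, frame_time hR]; simp; ring

/-- Pointwise real non-negativity (as complex values). [folklore] -/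
def RealNonneg {n : ℕ} (G : 𝓢((Fin n → E4), ℂ)) : Prop := ∀ p, 0 ≤ (G p).re ∧ (G p).im = 0

theorem RealNonneg.perm_lin {G : 𝓢((Fin 3 → E4), ℂ)} (hG : RealNonneg G) (τ : Equiv.Perm (Fin 3))
    (L : E4 ≃ₗᵢ[ℝ] E4) : RealNonneg (permTest τ (linActMulti L G)) := fun p => by
  rw [permTest_apply, linActMulti_apply]; exact hG _

theorem RealNonneg.I_re_nonneg {G : 𝓢((Fin 3 → E4), ℂ)} (hG : RealNonneg G) : 0 ≤ (I G).re := by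
  rw [I_apply]
  have hint : Integrable (fun z : Z8 => G (Ψ z)) :=
    ((SchwartzMap.compCLM ℂ (g := fun z : Z8 => Ψ z) Ψ.hasTemperateGrowth ⟨1, 4, norm_le_Ψ⟩) G).integrable
  have h := Complex.reCLM.integral_comp_comm hint
  simp only [Complex.reCLM_apply] at h
  rw [← h]
  exact integral_nonneg fun z => (hG _).1

theorem RealNonneg.T₃_re_ge {G : 𝓢((Fin 3 → E4), ℂ)} (hG : RealNonneg G) : (I G).re ≤ (T₃ G).re := by
  rw [T₃_apply, Complex.re_sum]
  simp_rw [Complex.re_sum]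
  have hnn : ∀ g : SignedPerm, ∀ τ : Equiv.Perm (Fin 3), 0 ≤ (I (permTest τ (linActMulti g.1 G))).re :=
    fun g τ => (hG.perm_lin τ g.1).I_re_nonneg
  calc (I G).re = (I (permTest 1 (linActMulti SignedPerm.one.1 G))).re := by
          rw [show SignedPerm.one.1 = LinearIsometryEquiv.refl ℝ E4 from rfl, linActMulti_refl, permTest_one]
    _ ≤ ∑ τ : Equiv.Perm (Fin 3), (I (permTest τ (linActMulti SignedPerm.one.1 G))).re :=
          Finset.single_le_sum (f := fun τ => (I (permTest τ (linActMulti SignedPerm.one.1 G))).re)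
            (fun τ _ => hnn _ τ) (Finset.mem_univ _)
    _ ≤ ∑ g : SignedPerm, ∑ τ : Equiv.Perm (Fin 3), (I (permTest τ (linActMulti g.1 G))).re :=
          Finset.single_le_sum (f := fun g : SignedPerm => ∑ τ : Equiv.Perm (Fin 3),
              (I (permTest τ (linActMulti g.1 G))).re)
            (fun g _ => Finset.sum_nonneg fun τ _ => hnn g τ) (Finset.mem_univ _)

variable (R)

/-- `G_A = R · (θF_A* ⊗ F_B)`: the degree-`(1,2)` test function of E2 in the diagonal frame. [folklore] -/
def GA : 𝓢((Fin 3 → E4), ℂ) :=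
  linActMulti R (SchwartzMap.appendTensor (osAdjoint (F₁ ha (cA R))) (F₂ ha (c₀ R) (c₁ R)))

/-- `G_B = R · (θF_B* ⊗ F_A)`: the degree-`(2,1)` test function. [folklore] -/
def GB : 𝓢((Fin 3 → E4), ℂ) :=
  linActMulti R (SchwartzMap.appendTensor (osAdjoint (F₂ ha (c₀ R) (c₁ R))) (F₁ ha (cA R)))

theorem GA_apply (p : Fin 3 → E4) : GA R ha p =
    (((bump ha (cA R)) (timeReflection 4 (R.symm (p 0))) *
      ((bump ha (c₀ R)) (R.symm (p 1)) * (bump ha (c₁ R)) (R.symm (p 2))) : ℝ) : ℂ) := by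
  rw [GA, linActMulti_apply, SchwartzMap.appendTensor_apply, osAdjoint_apply, F₁_apply, F₂_apply]
  simp only [Function.comp_apply, Complex.conj_ofReal, ← Complex.ofReal_mul]
  rfl

theorem GB_apply (p : Fin 3 → E4) : GB R ha p =
    ((((bump ha (c₀ R)) (timeReflection 4 (R.symm (p 1))) * (bump ha (c₁ R)) (timeReflection 4 (R.symm (p 0)))) *
      (bump ha (cA R)) (R.symm (p 2)) : ℝ) : ℂ) := by
  rw [GB, linActMulti_apply, SchwartzMap.appendTensor_apply, osAdjoint_apply, F₁_apply, F₂_apply]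
  simp only [Function.comp_apply, Complex.conj_ofReal, ← Complex.ofReal_mul]
  rfl

theorem realNonneg_GA : RealNonneg (GA R ha) := fun p => by
  rw [GA_apply, Complex.ofReal_re, Complex.ofReal_im]
  exact ⟨mul_nonneg (ContDiffBump.nonneg _) (mul_nonneg (ContDiffBump.nonneg _) (ContDiffBump.nonneg _)), rfl⟩

theorem realNonneg_GB : RealNonneg (GB R ha) := fun p => by
  rw [GB_apply, Complex.ofReal_re, Complex.ofReal_im]
  exact ⟨mul_nonneg (mul_nonneg (ContDiffBump.nonneg _) (ContDiffBump.nonneg _)) (ContDiffBump.nonneg _), rfl⟩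

/-- `G_A(Ψ z₀) = 1`: the carrier subspace `V ⊂ 𝒩` meets the rotated wedge. [folklore] -/
theorem GA_Ψ_z₀ : GA R ha (Ψ z₀) = 1 := by
  rw [GA_apply, Ψ_z₀]
  simp only [Matrix.cons_val_zero, Matrix.cons_val_one, Matrix.cons_val]
  rw [show timeReflection 4 (R.symm x₀) = cA R from rfl, show R.symm y₀ = c₀ R from rfl,
    show R.symm w₀ = c₁ R from rfl, bump_apply_self, bump_apply_self, bump_apply_self]
  simp

/-- `Re I(G_A) > 0`. [folklore] -/
theorem I_GA_re_pos : 0 < (I (GA R ha)).re := by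
  rw [I_apply]
  have hint : Integrable (fun z : Z8 => GA R ha (Ψ z)) :=
    ((SchwartzMap.compCLM ℂ (g := fun z : Z8 => Ψ z) Ψ.hasTemperateGrowth ⟨1, 4, norm_le_Ψ⟩) (GA R ha)).integrable
  have h := Complex.reCLM.integral_comp_comm hint
  simp only [Complex.reCLM_apply] at h
  rw [← h]
  refine integral_pos_of_integrable_nonneg_nonzero (x := z₀) ?_ hint.re (fun z => (realNonneg_GA R ha _).1) ?_
  · exact Complex.continuous_re.comp ((GA R ha).continuous.comp Ψ.continuous)
  · simp [GA_Ψ_z₀]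

end Witness

/-- **The diagonal frame sees the phantom**: `phantomFamily` is NOT reflection positive in the frame
`R e₀ = (e₀ + e₁)/√2`. E2 there with the two terms `−F_A` (degree 1) and `F_B` (degree 2) gives
`z = −T₃(G_A) − T₃(G_B)` with `Re T₃(G_B) ≥ 0` and `Re T₃(G_A) ≥ Re I(G_A) > 0`. [folklore] -/
theorem not_diagonalFrameRP_phantomFamily : ¬ DiagonalFrameRP phantomFamily := by
  intro hRP
  obtain ⟨R, a, ha2, ha, hR⟩ := exists_frame
  have hRPR := hRP R a a ha2 ha2 hR
  -- the two E2 terms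
  let deg : Fin 2 → ℕ := ![1, 2]
  let Ft : (j : Fin 2) → 𝓢((Fin (deg j) → E4), ℂ) := fun j =>
    match j with
    | ⟨0, _⟩ => -F₁ ha (cA R)
    | ⟨1, _⟩ => F₂ ha (c₀ R) (c₁ R)
  have hA : IsTimeOrdered (F₁ ha (cA R)) := isTimeOrdered_F₁ ha (by rw [cA_zero hR]; linarith)
  have hB : IsTimeOrdered (F₂ ha (c₀ R) (c₁ R)) :=
    isTimeOrdered_F₂ ha (by rw [c₀_zero hR]; linarith) (by rw [c₀_zero hR, c₁_zero hR]; linarith)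
  have hT : ∀ j, IsTimeOrdered (Ft j) := by
    intro j
    match j with
    | ⟨0, _⟩ =>
      show IsTimeOrdered (-F₁ ha (cA R))
      intro p hp
      apply hA
      have hts : tsupport (⇑(-F₁ ha (cA R))) = tsupport (⇑(F₁ ha (cA R))) := by
        change closure (Function.support (-⇑(F₁ ha (cA R)))) = closure (Function.support ⇑(F₁ ha (cA R)))
        rw [Function.support_neg]
      rwa [hts] at hp
    | ⟨1, _⟩ => exact hB
  have key := hRPR 2 deg (fun _ _ => ()) Ft hT
    (fun i j => SchwartzMap.appendTensor (osAdjoint (Ft i)) (Ft j))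
    (fun i j => isAppendTensorOf_appendTensor _ _)
  obtain ⟨hre, -⟩ := key
  -- expand the `2 × 2` sum
  simp only [Fin.sum_univ_two, SchwingerFamily.toLabelled_apply, ContinuousLinearMap.comp_apply] at hre
  have h00 : phantomFamily (deg 0 + deg 0) = 0 := by
    show phantomFamily 2 = 0
    ext G; rw [phantomFamily_apply, vacuumFamily_apply, phantom_of_ne_three (by decide)]; simp
  have h11 : phantomFamily (deg 1 + deg 1) = 0 := by
    show phantomFamily 4 = 0
    ext G; rw [phantomFamily_apply, vacuumFamily_apply, phantom_of_ne_three (by decide)]; simp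
  have h3 : ∀ G, phantomFamily 3 G = T₃ G := fun G => by
    rw [phantomFamily_apply, vacuumFamily_apply, if_neg (by decide), phantom_three, zero_add]
  have h01 : phantomFamily (deg 0 + deg 1) (linActMulti R (SchwartzMap.appendTensor (osAdjoint (Ft 0)) (Ft 1))) =
      -T₃ (GA R ha) := by
    show phantomFamily 3 (linActMulti R (SchwartzMap.appendTensor (osAdjoint (-F₁ ha (cA R))) (F₂ ha (c₀ R) (c₁ R)))) = _
    rw [h3, GA]
    have hneg : ∀ y, (-F₁ ha (cA R)) y = -(F₁ ha (cA R) y) := fun _ => rfl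
    have : SchwartzMap.appendTensor (osAdjoint (-F₁ ha (cA R))) (F₂ ha (c₀ R) (c₁ R)) =
        -SchwartzMap.appendTensor (osAdjoint (F₁ ha (cA R))) (F₂ ha (c₀ R) (c₁ R)) := by
      ext p
      show _ = -(SchwartzMap.appendTensor (osAdjoint (F₁ ha (cA R))) (F₂ ha (c₀ R) (c₁ R)) p)
      simp only [SchwartzMap.appendTensor_apply, osAdjoint_apply, hneg, map_neg, neg_mul]
    rw [this, map_neg, map_neg]
  have h10 : phantomFamily (deg 1 + deg 0) (linActMulti R (SchwartzMap.appendTensor (osAdjoint (Ft 1)) (Ft 0))) =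
      -T₃ (GB R ha) := by
    show phantomFamily 3 (linActMulti R (SchwartzMap.appendTensor (osAdjoint (F₂ ha (c₀ R) (c₁ R))) (-F₁ ha (cA R)))) = _
    rw [h3, GB]
    have hneg : ∀ y, (-F₁ ha (cA R)) y = -(F₁ ha (cA R) y) := fun _ => rfl
    have : SchwartzMap.appendTensor (osAdjoint (F₂ ha (c₀ R) (c₁ R))) (-F₁ ha (cA R)) =
        -SchwartzMap.appendTensor (osAdjoint (F₂ ha (c₀ R) (c₁ R))) (F₁ ha (cA R)) := by
      ext p
      show _ = -(SchwartzMap.appendTensor (osAdjoint (F₂ ha (c₀ R) (c₁ R))) (F₁ ha (cA R)) p)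
      simp only [SchwartzMap.appendTensor_apply, hneg, mul_neg]
    rw [this, map_neg, map_neg]
  rw [h00, h11, h01, h10] at hre
  simp only [zero_apply, zero_add, add_zero, Complex.add_re, Complex.neg_re] at hre
  have hGA : 0 < (T₃ (GA R ha)).re := (I_GA_re_pos R ha).trans_le ((realNonneg_GA R ha).T₃_re_ge)
  have hGB : 0 ≤ (T₃ (GB R ha)).re := ((realNonneg_GB R ha).I_re_nonneg).trans ((realNonneg_GB R ha).T₃_re_ge)
  linarith

/-- **`hconv` is load-bearing: the crux with the lattice-convergence clause deleted is FALSE.**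
Witness: `G = SU(2)`, fundamental representation, zero scheme, and the phantom family (which carries the
whole of `W₁ ∖ hconv`, `packageWithoutConvergence_phantomFamily`, but is not diagonally RP,
`not_diagonalFrameRP_phantomFamily`). Hence ANY proof of `DiagonalMirrorRPR` must use `hconv`, and use it in
degrees `≥ 3` on the blind spot `𝒩` of the e₀-based axioms. [folklore] -/
theorem cruxWithoutLatticeConvergence_false : ¬ CruxWithoutLatticeConvergence := by
  intro h
  have hG : IsCompactSimpleLieGroup (Matrix.specialUnitaryGroup (Fin 2) ℂ) :=
    isCompactSimpleLieGroup_specialUnitaryGroup isSimpleCompactGroup_specialUnitaryGroup_holds le_rfl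
  letI : MeasurableSpace (Matrix.specialUnitaryGroup (Fin 2) ℂ) := borel _
  haveI : BorelSpace (Matrix.specialUnitaryGroup (Fin 2) ℂ) := ⟨rfl⟩
  let r : LatticeRep (Matrix.specialUnitaryGroup (Fin 2) ℂ) :=
    ⟨2, fundamentalRep (Fin 2), continuous_fundamentalRep _, fundamentalRep_injective _, fundamentalRep_mem_unitaryGroup⟩
  exact not_diagonalFrameRP_phantomFamily
    (h _ hG r (SpeciesScheme.zero _) phantomFamily (packageWithoutConvergence_phantomFamily r))


end Phantom

/-! ## §9 (cycle 3) Diagonal RP is ACTION-specific: an honest axis-RP lattice scaling limit that is not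
diagonally RP — exact two-point certificate

**Claim refuted (natural strengthening, kernel level).** "A translation-invariant two-point function on `ℝ⁴`
(or `ℤ⁴`) that is reflection positive across the four AXIS mirrors, invariant under the signed permutations
`W(B₄)`, and exponentially clustering is reflection positive across the diagonal mirror `x₀ + x₁ = 0`."  FALSE:
`C(x) = e^{-m‖x‖₁}` (here at lattice points with `m·a = log 2`, i.e. `K(v) = 2^{-‖v‖₁}`; the coordinates
`x₂ = x₃ = 0` are spectators).

* `C` IS a two-point Schwinger function with everything the package `W₁ ∖ hconv` asks at degree 2, and more:
  it is positive-definite (`∏_μ` of the AR(1)/Ornstein–Uhlenbeck covariances `2^{-|s-t|}`, Schur), hence the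
  covariance of a Gaussian (generalised free) field — the **ℓ¹-Gaussian**; it is `W(B₄)`- and
  translation-invariant; it is RP across EVERY axis site-mirror (`x₀ ↦ −x₀`: `C(x − θ₀y) = 2^{-x₀}2^{-y₀}·∏_{μ≥1}
  2^{-|x_μ−y_μ|}` = rank one ⊗ positive-definite; Gram identity `2^{-|s−t|} = (3/4)∑_{r ≤ min(s,t)} 2^{r−s}2^{r−t}`);
  it clusters exponentially at rate `m` in every direction (`‖x‖₁ ≥ |x_μ|`), so the Gaussian field has the
  e₀-mass gap `m` and E0', E3, E4 (Wick); and it is an HONEST LATTICE SCALING LIMIT WITH A UNIFORM LATTICE GAP: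
  the Gaussian lattice field on `aℤ⁴` with covariance `λ^{‖x−y‖₁/a}`, `λ = e^{-ma}`, has precision matrix
  `⊗_μ (tridiagonal)` = finite-range couplings (`|x_μ − y_μ| ≤ a` for all `μ`: the 80 neighbours of the unit
  cube), is site-RP across all four axis hyperplanes for every `a` (no coupling crosses a site plane strictly,
  FILS I, reflections in site planes), has lattice mass gap `ma` per lattice unit = `m` in physical units uniformly in `a` and in
  the volume, and its covariance restricted to physical points does not depend on `a` at all.
* Yet `C` is NOT diagonally RP: in light-cone variables `u = (x₀+x₁)/√2`, `v = (x₀−x₁)/√2` one has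
  `‖x‖₁ = √2·max(|u|,|v|)` on the plane, and the `v`-Fourier transform of the reflected kernel,
  `k_q(U) = (2c e^{-cU}/(c²+q²))·[(c/q) sin(qU) + cos(qU)]` (`c = √2 m`, `U = u + u' > 0`), changes sign in `U`,
  so it is not exponentially convex (Bernstein–Widder) — diagonal OS positivity fails already for vectors
  `φ(f)Ω`, `f` one test function.  EXACT CERTIFICATE (`diagForm_eq`, `not_kernelRP_l1_diag`): the three
  lattice points `(3,−1), (5,−3), (7,−5)` of the open quadrant `{x₀ > 0 > x₁}` (so also the quadrant /
  `*`-semigroup form of swap-RP of `SeamAlgebraIdeator1.md` item 8 fails) with real coefficients `1, −1, 1` give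
  `∑ cᵢcⱼ K(pᵢ − θ_d pⱼ) = −7/128 < 0`, while the axis form of the same configuration is `241/16384 > 0`
  (`axisForm_eq`), and axis RP holds on EVERY configuration (`kernelRP_l1_axis`, proved from the Gram identity
  `half_pow_natDist_eq` of the AR(1) kernel).

**Moral for provers.** Diagonal RP of a Wilson limit cannot come from {axis RP in all four axes, `W(B₄)`,
translations, OS package, continuum gap, uniform LATTICE gap of an RP finite-range lattice regularisation,
Gaussianity}: the ℓ¹-Gaussian has all of these.  It must come from the specific form of Wilson's plaquette
action — the diagonal site-mirror cuts a `(0,1)`-plaquette along its diagonal into `P₊(θP₊)†` and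
`exp(β Re tr(gh†))` is Schur-positive for `β ≥ 0` (FILS cone; the 45° cover of `Ideas/fortyfive-cover-descent.md`)
— transported to the statement's odd tori.  Equivalently: in `hconv` it is not "convergence from SOME gapped RP
lattice model" that matters but convergence from THIS action.  (The ℓ¹-lattice model is exactly the kind of
nearest-cube RP model for which every volume-blind / model-blind insensitivity argument would equally apply.)
Barrier candidate: `Literature/Barriers/QuantumFields/AxisRPNotDiagonalRP` (ℓ¹-Gaussian). -/

namespace L1Kernel

/-- `ℓ¹`-norm on `ℤ²` (the `(x₀,x₁)`-plane of the lattice `ℤ⁴`; `x₂, x₃` are spectators). [folklore] -/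
def l1 (v : ℤ × ℤ) : ℕ := v.1.natAbs + v.2.natAbs

/-- The ℓ¹-Gaussian two-point kernel `K(v) = 2^{-‖v‖₁}` (`= e^{-m‖x−y‖₁}` at lattice points, `ma = log 2`). [folklore] -/
def K (v : ℤ × ℤ) : ℚ := (1 / 2 : ℚ) ^ l1 v

/-- Reflection across the DIAGONAL mirror `x₀ + x₁ = 0` (unit normal `(e₀+e₁)/√2`, the crux's frame
`R e₀ = a e₀ + a e₁`): `(x₀,x₁) ↦ (−x₁,−x₀)`. [folklore] -/
def θd (v : ℤ × ℤ) : ℤ × ℤ := (-v.2, -v.1)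

/-- Reflection across the AXIS mirror `x₀ = 0`: `(x₀,x₁) ↦ (−x₀,x₁)`. [folklore] -/
def θ₀ (v : ℤ × ℤ) : ℤ × ℤ := (-v.1, v.2)

/-- **Kernel-level reflection positivity** of a translation-invariant two-point function `C` on `ℤ²` across the
mirror of the reflection `θ`, for configurations in the region `P` (the open half-space of the mirror, or a
smaller region): every finite real configuration has a non-negative RP form `∑ᵢⱼ cᵢcⱼ C(pᵢ − θpⱼ)`.  This is
exactly degree-`(1,1)` OS positivity `𝔖₂(θf̄ ⊗ f) ≥ 0` for finitely supported `f`. [folklore] -/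
def KernelRP (C : ℤ × ℤ → ℚ) (θ : ℤ × ℤ → ℤ × ℤ) (P : ℤ × ℤ → Prop) : Prop :=
  ∀ (n : ℕ) (p : Fin n → ℤ × ℤ) (c : Fin n → ℚ), (∀ i, P (p i)) →
    0 ≤ ∑ i, ∑ j, c i * c j * C (p i - θ (p j))

/-- Gram vectors of the AR(1)/OU lattice kernel: `φ r S = 2^r (1/2)^S` for `r ≤ S`, else `0`. [folklore] -/
def φ (r S : ℕ) : ℚ := if r ≤ S then (2 : ℚ) ^ r * (1 / 2 : ℚ) ^ S else 0

/-- **Gram identity** for the AR(1)/OU lattice kernel: for `S ≤ M` (and any `T`),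
`(1/2)^{|S−T|} = (3/4) ∑_{r ≤ M} φ_r(S) φ_r(T) + (1/2)^{S+1} (1/2)^{T+1}` — the moving-average representation
`X_t = ∑_{r ≤ t} 2^{r−t} ε_r` of the AR(1) process with parameter `1/2`, truncated at `r ≥ 0` with the rank-one
remainder. [folklore] -/
theorem half_pow_natDist_eq (S T M : ℕ) (hS : S ≤ M) :
    (1 / 2 : ℚ) ^ Int.natAbs ((S : ℤ) - T) =
      3 / 4 * ∑ r ∈ Finset.range (M + 1), φ r S * φ r T + (1 / 2 : ℚ) ^ (S + 1) * (1 / 2) ^ (T + 1) := by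
  -- reduce the indicator sum to a geometric sum over `r ≤ min S T`
  have hsum : ∑ r ∈ Finset.range (M + 1), φ r S * φ r T =
      (1 / 2 : ℚ) ^ S * (1 / 2 : ℚ) ^ T * ∑ r ∈ Finset.range (min S T + 1), (4 : ℚ) ^ r := by
    have hfilter : ∀ r ∈ Finset.range (M + 1), φ r S * φ r T =
        if r ∈ Finset.range (min S T + 1) then (1 / 2 : ℚ) ^ S * (1 / 2 : ℚ) ^ T * (4 : ℚ) ^ r else 0 := by
      intro r _
      by_cases h : r ≤ min S T
      · have h1 : r ≤ S := h.trans (min_le_left _ _)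
        have h2 : r ≤ T := h.trans (min_le_right _ _)
        have hr : r ∈ Finset.range (min S T + 1) := Finset.mem_range.2 (Nat.lt_succ_of_le h)
        simp only [φ, h1, h2, hr, ↓reduceIte]
        have h4 : (4 : ℚ) ^ r = 2 ^ r * 2 ^ r := by
          rw [← mul_pow]; norm_num
        rw [h4]; ring
      · have hr : r ∉ Finset.range (min S T + 1) := by
          rw [Finset.mem_range]; omega
        simp only [hr, ↓reduceIte, φ]
        rcases Nat.lt_or_ge S r with h1 | h1
        · simp [Nat.not_le.2 h1]
        · have h2 : ¬ r ≤ T := by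
            intro h2; exact h (le_min h1 h2)
          simp [h2]
    rw [Finset.sum_congr rfl hfilter, ← Finset.sum_filter, Finset.mul_sum]
    congr 1
    ext r
    simp only [Finset.mem_filter, Finset.mem_range]
    omega
  rw [hsum, geom_sum_eq (by norm_num : (4 : ℚ) ≠ 1)]
  -- both sides equal `(1/2)^(S+T) * 4^(min S T)`
  have hnat : Int.natAbs ((S : ℤ) - T) + 2 * min S T = S + T := by omega
  have key : (1 / 2 : ℚ) ^ Int.natAbs ((S : ℤ) - T) = (1 / 2 : ℚ) ^ S * (1 / 2) ^ T * 4 ^ min S T := by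
    have h := congrArg (fun n : ℕ => (1 / 2 : ℚ) ^ n) hnat
    simp only [pow_add, pow_mul] at h
    have h4 : ((1 / 2 : ℚ) ^ 2) ^ min S T * (4 : ℚ) ^ min S T = 1 := by
      rw [← mul_pow]; norm_num
    calc (1 / 2 : ℚ) ^ Int.natAbs ((S : ℤ) - T)
        = (1 / 2 : ℚ) ^ Int.natAbs ((S : ℤ) - T) * (((1 / 2 : ℚ) ^ 2) ^ min S T * (4 : ℚ) ^ min S T) := by
          rw [h4, mul_one]
      _ = ((1 / 2 : ℚ) ^ Int.natAbs ((S : ℤ) - T) * ((1 / 2 : ℚ) ^ 2) ^ min S T) * (4 : ℚ) ^ min S T := by ring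
      _ = (1 / 2 : ℚ) ^ S * (1 / 2) ^ T * 4 ^ min S T := by rw [h]
  rw [key]
  ring

/-- **The AR(1)/OU lattice kernel `(1/2)^{|S−T|}` is positive semi-definite** (Gram representation). [folklore] -/
theorem psd_half_pow_natDist {n : ℕ} (S : Fin n → ℕ) (d : Fin n → ℚ) :
    0 ≤ ∑ i, ∑ j, d i * d j * (1 / 2 : ℚ) ^ Int.natAbs ((S i : ℤ) - S j) := by
  set M : ℕ := ∑ i, S i with hM
  have hle : ∀ i, S i ≤ M := fun i =>
    Finset.single_le_sum (f := S) (fun _ _ => Nat.zero_le _) (Finset.mem_univ i)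
  -- Gram vectors
  set T : ℕ → Fin n → ℚ := fun r i => d i * φ r (S i) with hT
  set U : Fin n → ℚ := fun i => d i * (1 / 2 : ℚ) ^ (S i + 1) with hU
  have hrw : ∀ i j, d i * d j * (1 / 2 : ℚ) ^ Int.natAbs ((S i : ℤ) - S j) =
      3 / 4 * ∑ r ∈ Finset.range (M + 1), T r i * T r j + U i * U j := by
    intro i j
    rw [half_pow_natDist_eq (S i) (S j) M (hle i)]
    simp only [hT, hU, mul_add, Finset.mul_sum]
    congr 1
    · exact Finset.sum_congr rfl fun r _ => by ring
    · ring
  have hD : ∑ i, ∑ j, ∑ r ∈ Finset.range (M + 1), T r i * T r j =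
      ∑ r ∈ Finset.range (M + 1), (∑ i, T r i) * (∑ j, T r j) := by
    calc ∑ i, ∑ j, ∑ r ∈ Finset.range (M + 1), T r i * T r j
        = ∑ i, ∑ r ∈ Finset.range (M + 1), ∑ j, T r i * T r j :=
          Finset.sum_congr rfl fun i _ => Finset.sum_comm
      _ = ∑ r ∈ Finset.range (M + 1), ∑ i, ∑ j, T r i * T r j := Finset.sum_comm
      _ = ∑ r ∈ Finset.range (M + 1), (∑ i, T r i) * (∑ j, T r j) :=
          Finset.sum_congr rfl fun r _ => by rw [Finset.sum_mul_sum]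
  rw [show ∑ i, ∑ j, d i * d j * (1 / 2 : ℚ) ^ Int.natAbs ((S i : ℤ) - S j) =
      ∑ i, ∑ j, (3 / 4 * ∑ r ∈ Finset.range (M + 1), T r i * T r j + U i * U j) from
    Finset.sum_congr rfl fun i _ => Finset.sum_congr rfl fun j _ => hrw i j]
  simp only [Finset.sum_add_distrib]
  refine add_nonneg ?_ ?_
  · simp only [← Finset.mul_sum]
    rw [hD]
    exact mul_nonneg (by norm_num) (Finset.sum_nonneg fun r _ => mul_self_nonneg _)
  · rw [← Finset.sum_mul_sum]
    exact mul_self_nonneg _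

/-- **The ℓ¹-Gaussian kernel IS reflection positive across the AXIS mirror `x₀ = 0`, on every finite
configuration in `{x₀ > 0}`**: `K(pᵢ − θ₀pⱼ) = (1/2)^{xᵢ}(1/2)^{xⱼ}·(1/2)^{|yᵢ−yⱼ|}` is (rank one) ⊗ (PSD).  By the
`W(B₂)`-symmetry of `K` the same holds for the mirror `x₁ = 0`; contrast `not_kernelRP_l1_diag`. [folklore] -/
theorem kernelRP_l1_axis : KernelRP K θ₀ (fun v => 0 < v.1) := by
  intro n p c hp
  -- shift the `y`-coordinates to naturals
  set B : ℤ := -∑ i, |(p i).2| with hB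
  have hBle : ∀ i, B ≤ (p i).2 := fun i => by
    have h1 : |(p i).2| ≤ ∑ j, |(p j).2| :=
      Finset.single_le_sum (f := fun j => |(p j).2|) (fun _ _ => abs_nonneg _) (Finset.mem_univ i)
    have h2 : -|(p i).2| ≤ (p i).2 := neg_abs_le _
    omega
  let S : Fin n → ℕ := fun i => ((p i).2 - B).toNat
  have hS : ∀ i, (S i : ℤ) = (p i).2 - B := fun i => Int.toNat_of_nonneg (by linarith [hBle i])
  let X : Fin n → ℕ := fun i => ((p i).1).toNat
  have hX : ∀ i, (X i : ℤ) = (p i).1 := fun i => Int.toNat_of_nonneg (hp i).le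
  have hK : ∀ i j, K (p i - θ₀ (p j)) =
      (1 / 2 : ℚ) ^ X i * (1 / 2 : ℚ) ^ X j * (1 / 2 : ℚ) ^ Int.natAbs ((S i : ℤ) - S j) := by
    intro i j
    simp only [K, l1, θ₀, Prod.fst_sub, Prod.snd_sub, sub_neg_eq_add]
    have h1 : ((p i).1 + (p j).1).natAbs = X i + X j := by
      have := hX i; have := hX j; omega
    have h2 : ((p i).2 - (p j).2).natAbs = Int.natAbs ((S i : ℤ) - S j) := by
      rw [hS i, hS j]; congr 1; ring
    rw [h1, h2, pow_add, pow_add]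
  simp_rw [hK]
  have := psd_half_pow_natDist S (fun i => c i * (1 / 2 : ℚ) ^ X i)
  convert this using 2 with i _
  refine Finset.sum_congr rfl fun j _ => ?_
  ring

/-- The witness configuration: three points of the open quadrant `{x₀ > 0 > x₁}` on the diagonal-time slice
`x₀ + x₁ = 2`, spaced by `2(e₀ − e₁)` (a period-4 stagger along the mirror, i.e. `v`-momentum `q` with
`2nq = π` in the Fourier computation of the section docstring). [folklore] -/
def wPts : Fin 3 → ℤ × ℤ := ![(3, -1), (5, -3), (7, -5)]

/-- The witness coefficients `1, −1, 1`. [folklore] -/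
def wCoef : Fin 3 → ℚ := ![1, -1, 1]

/-- The witness lies in the open quadrant `{x₀ > 0 > x₁}`. [folklore] -/
theorem wPts_quadrant : ∀ i, 0 < (wPts i).1 ∧ (wPts i).2 < 0 := by decide

/-- The witness lies in the open half-space `{x₀ + x₁ > 0}` of the diagonal mirror. [folklore] -/
theorem wPts_halfspace : ∀ i, 0 < (wPts i).1 + (wPts i).2 := by decide

/-- The witness lies in the open half-space `{x₀ > 0}` of the axis mirror. [folklore] -/
theorem wPts_axis_halfspace : ∀ i, 0 < (wPts i).1 := by decide

/-- **Exact value of the diagonal RP form on the witness: `−7/128`.**  (Gram entries `K(pᵢ − θ_d pⱼ)`: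
`1/16` on and next to the diagonal, `1/256` in the corners; `3/16 − 4/16 + 2/256 = −7/128`.) [folklore] -/
theorem diagForm_eq : ∑ i, ∑ j, wCoef i * wCoef j * K (wPts i - θd (wPts j)) = -7 / 128 := by
  simp [Fin.sum_univ_three, wPts, wCoef, K, l1, θd]
  norm_num

/-- Sanity / contrast: the AXIS RP form of the same configuration is `241/16384 > 0` (as it must be:
`kernelRP_l1_axis`). [folklore] -/
theorem axisForm_eq : ∑ i, ∑ j, wCoef i * wCoef j * K (wPts i - θ₀ (wPts j)) = 241 / 16384 := by
  simp [Fin.sum_univ_three, wPts, wCoef, K, l1, θ₀]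
  norm_num

/-- **The ℓ¹-Gaussian two-point function is not diagonally RP, already on the open quadrant `{x₀ > 0 > x₁}`**
(so the quadrant / `*`-semigroup `((0,∞)², +, (a,b)* = (b,a))` form of swap positivity fails for it too). [folklore] -/
theorem not_kernelRP_l1_quadrant : ¬ KernelRP K θd (fun v => 0 < v.1 ∧ v.2 < 0) := fun h => by
  have h1 := h 3 wPts wCoef wPts_quadrant
  rw [diagForm_eq] at h1
  norm_num at h1

/-- **The ℓ¹-Gaussian two-point function `2^{-‖x−y‖₁}` — axis-RP in all four axes, `W(B₄)`-invariant,
exponentially clustering, an honest finite-range RP lattice scaling limit with a uniform lattice gap — is NOT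
reflection positive across the diagonal mirror `x₀ + x₁ = 0`.**  Diagonal RP is action-specific. [folklore] -/
theorem not_kernelRP_l1_diag : ¬ KernelRP K θd (fun v => 0 < v.1 + v.2) := fun h => by
  have h1 := h 3 wPts wCoef wPts_halfspace
  rw [diagForm_eq] at h1
  norm_num at h1

end L1Kernel

/-! ## §10 (cycle 3) `β < 0` on the statement's odd tori is the maximal 't Hooft twist (`SU(2)`): the
parity obstruction, slice by slice

The crux leaves `sch.β k ∈ ℝ` free (§5: the diagonal Schur cut needs `β ≥ 0`).  For `SU(2)` in the fundamental
representation the regime `β_k < 0` is NOT a new model on `ℤ⁴` or on even tori (centre flip), but on the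
statement's odd tori `(ℤ/(2L_k+1))⁴` it is positive coupling with the maximal 't Hooft twist — recorded here as
the exact ℤ₂ statement behind it.  (For `SU(3)` and other `ρ` with `−1 ∉ ρ(Z(G))`, negative coupling is a
genuinely different and uncontrolled lattice model; either way no rigorously controlled non-ultralocal limit is
available there, findings item 9.) -/

namespace OddTorusTwist

/-- Sites of a coordinate 2-torus slice `(ℤ/S)²` of the statement's 4-torus. [folklore] -/
abbrev T2 (S : ℕ) : Type := ZMod S × ZMod S

variable {S : ℕ}

/-- ℤ₂-valued plaquette of an edge-sign field `ε` (direction `0`/`1` = the `e₀`/`e₁`-edge issuing from the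
site; additive `ℤ₂`, so orientations are immaterial): `ε(x,0) + ε(x+e₀,1) + ε(x+e₁,0) + ε(x,1)`. [folklore] -/
def plaq (ε : T2 S → Fin 2 → ZMod 2) (x : T2 S) : ZMod 2 :=
  ε x 0 + ε (x + (1, 0)) 1 + ε (x + (0, 1)) 0 + ε x 1

/-- Every edge lies in exactly two plaquettes: `∑ₓ plaq ε x = 0` in `ℤ₂` (any `S`). [folklore] -/
theorem sum_plaq [NeZero S] (ε : T2 S → Fin 2 → ZMod 2) : ∑ x, plaq ε x = 0 := by
  simp only [plaq, Finset.sum_add_distrib]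
  have h1 : ∑ x : T2 S, ε (x + (1, 0)) 1 = ∑ x : T2 S, ε x 1 :=
    Fintype.sum_equiv (Equiv.addRight ((1, 0) : T2 S)) _ _ fun _ => rfl
  have h2 : ∑ x : T2 S, ε (x + (0, 1)) 0 = ∑ x : T2 S, ε x 0 :=
    Fintype.sum_equiv (Equiv.addRight ((0, 1) : T2 S)) _ _ fun _ => rfl
  rw [h1, h2]
  have key : ∀ a b : ZMod 2, a + b + a + b = 0 := by decide
  exact key _ _

/-- **Odd 2-tori cannot be fully frustrated**: for odd `S` no ℤ₂ edge-sign field on `(ℤ/S)²` has all `S²`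
plaquettes equal to `−1` (additively `1`), since `∑ₓ plaq = 0` while `S² ≡ 1 (mod 2)`.  GAUGE READING (`SU(2)`,
fundamental `ρ`, centre `−1 = ρ(−1)` scalar): the change of variables `U_e ↦ ε_e U_e` maps Wilson's weight at
coupling `β` with plaquette signs `η_p` to coupling `β` with signs `η_p·(δε)_p`; NEGATIVE coupling is positive
coupling with all signs `−1`; on `ℤ⁴` and on EVEN tori the all-`(−1)` sign field is a coboundary
(`even_torus_fully_frustrated`), so there `β < 0 ≡ β > 0` exactly, but on the statement's ODD tori
`(ℤ/(2L+1))⁴` it is not — its class is the maximal 't Hooft twist `n_μν ≡ 1 (mod 2)` in all six planes (this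
lemma, slice by slice).  So `β_k < 0` (allowed by the crux) on the statement's tori is `|β_k|` with twisted
boundary conditions: no counterexample is expected (twist free energies of a massive phase vanish / are
string-suppressed in the volume), but the intended proof's diagonal Schur cut (`β ≥ 0`) has no `β < 0` analogue
and the sign flip does not restore it on odd geometries. [folklore] -/
theorem odd_torus_not_fully_frustrated [NeZero S] (hS : Odd S) (ε : T2 S → Fin 2 → ZMod 2) :
    ¬ ∀ x, plaq ε x = 1 := by
  intro h
  have hsum := sum_plaq ε
  simp only [h, Finset.sum_const, Finset.card_univ, nsmul_eq_mul, mul_one] at hsum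
  rw [Fintype.card_prod, ZMod.card, Nat.cast_mul] at hsum
  have hodd : ((S : ZMod 2)) = 1 := by
    rcases hS with ⟨k, rfl⟩
    push_cast
    have : (2 : ZMod 2) = 0 := by decide
    rw [this]; ring
  rw [hodd, mul_one] at hsum
  exact one_ne_zero hsum

/-- **Even 2-tori are fully frustratable**: on `(ℤ/2M)²` the edge signs `ε(x, e₁) = parity(x₀)`, `ε(x, e₀) = 0`
make every plaquette `−1`; hence for `SU(2)` (fundamental) Wilson theory on even tori and on `ℤ⁴`, coupling `−β`
is coupling `β` after a Haar-preserving change of variables. [folklore] -/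
theorem even_torus_fully_frustrated (M : ℕ) [NeZero M] :
    ∃ ε : T2 (2 * M) → Fin 2 → ZMod 2, ∀ x, plaq ε x = 1 := by
  haveI : NeZero (2 * M) := ⟨mul_ne_zero two_ne_zero (NeZero.ne M)⟩
  let π : ZMod (2 * M) →+* ZMod 2 := ZMod.castHom (dvd_mul_right 2 M) (ZMod 2)
  refine ⟨fun x μ => if μ = 1 then π x.1 else 0, fun x => ?_⟩
  simp only [plaq, ↓reduceIte, Prod.fst_add, map_add, map_one, add_zero]
  have key : ∀ a : ZMod 2, a + 1 + a = 1 := by decide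
  simpa [add_comm, add_left_comm, add_assoc] using key (π x.1)

end OddTorusTwist

end Summit.QuantumFields.YangMills.Cruxes.DiagonalMirrorRPR.Disproof
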